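import Literature.NumberTheory.EllipticCurves.RohrlichNonvanishingProofs
import Literature.NumberTheory.EllipticCurves.NewformPeriodsCoeffField
import Literature.NumberTheory.EllipticCurves.NewformsCoeffFieldHolds
import Mathlib.FieldTheory.IntermediateField.Adjoin.Basic
import Mathlib.RingTheory.Polynomial.Cyclotomic.Roots
import Mathlib.NumberTheory.Padics.PadicVal.Basic
import Mathlib.GroupTheory.Index
import HarnessLib

/-!
# Rohrlich's non-vanishing theorem for twists of `p`-power conductor — arbitrary newforms,
# given a coefficient bound (the Galois step over the coefficient field `K_f`)

Topic `NumberTheory/EllipticCurves`; continuation of `RohrlichNonvanishingProofs` (which proves the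
case of *rational* newforms, in particular of elliptic curves over `ℚ`) towards the named fact
`Rohrlich1984_nonvanishing_twists` of `RohrlichNonvanishing` (Rohrlich 1984, Theorem p. 409, for
*every* newform on `Γ₀(N)` and every finite set `P` of primes). This file removes the rationality
hypothesis: for a normalised newform `f ∈ S₂(Γ₀(N))` with arbitrary coefficient field
`K_f = ℚ(aₙ(f))` and a prime `p ∤ N`,

* `Rohrlich1984_primePow_of_coeffBound` — if `|aₙ(f)| ≤ C n^θ` for some `θ < 2/3`, only finitely
  many primitive Dirichlet characters `χ` of `p`-power conductor have `L(f, χ, 1) = 0`;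
* `Rohrlich1984_nonvanishing_twists.primePow_of_coeffBound` — the same with the hypotheses of the
  corollary `Rohrlich1984_nonvanishing_twists.primePow` verbatim (`p ∤ N` any natural number).

The only remaining input for `Rohrlich1984_nonvanishing_twists.primePow` in general is thus the
coefficient bound, i.e. the Ramanujan–Petersson estimate `|aₙ(f)| ≤ d(n) √n` for weight-`2` newforms
(Eichler 1954, Shimura 1958, Igusa 1959; Deligne 1974, Thm. 8.2), which Rohrlich's paper uses and the
tree does not have (D-0026: it is not introduced here as a named fact).

## The argument (Rohrlich 1984, §1, over `K_f`; §§2–4 unchanged)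

1. *Galois conjugation over `K_f`* (`twistedSymbolSum_pow_eq_zero_of_modEq_one`). By Shimura's
   theorem on the periods of `f` over `K_f` (`IsNewform0.exists_plusSymbol_eq_mul`,
   `IsNewform0.exists_minusSymbol_eq_mul` of `NewformPeriodsCoeffField`: `plusSymbol f r ∈ K_f Ω⁺`,
   `minusSymbol f r ∈ K_f iΩ⁻`), the symbol sum `S(χ) = ∑_a χ(a){∞, a/p^m}_f` is `Ω^± ∑_a χ(a) q_a`
   with `q_a ∈ K_f`; if it vanishes, the polynomial `∑ q_a X^{e_a} ∈ K_f[X]` (`χ(a) = ζ^{e_a}`,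
   `ζ = e^{2πi/φ(p^m)}`) is divisible by `minpoly_{K_f} ζ`, so `S(χ^k) = 0` whenever `ζ^k` is a
   `K_f`-conjugate of `ζ` (`sum_pow_apply_mul_eq_zero_of_aeval_minpoly`).
2. *The admissible exponents* (`aeval_pow_minpoly_eq_zero_of_modEq_one`): every
   `k ≡ 1 (mod p^e (p-1))` with `e = v_p([K_f:ℚ]!) + 2` is admissible, for every `m` — the image of
   `Gal(K_f(μ_{p^∞})/K_f)` in `ℤ_pˣ` contains `1 + p^e ℤ_p`. Proof without Galois theory: the
   admissible classes form a subgroup `R ≤ (ℤ/D)ˣ`, `D = φ(p^m)` (closed under products by the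
   trick `μ ∣ μ(X^b)` proving the irreducibility of cyclotomic polynomials,
   `aeval_pow_mul_minpoly_eq_zero`), of order `≥ deg minpoly_{K_f} ζ = [K_f(ζ):K_f] ≥ φ(D)/[K_f:ℚ]`
   (its elements index the roots of the separable divisor `minpoly_{K_f} ζ` of `Φ_D`; tower law), so
   of index `≤ n = [K_f:ℚ]` and containing all `n!`-th powers (`aeval_pow_factorial_minpoly_eq_zero`);
   and `k ≡ 1 (mod p^e (p-1))` *is* an `n!`-th power in `(ℤ/p^a(p-1))ˣ`
   (`exists_units_pow_eq_of_modEq_one`): modulo `p^a`, in the filtration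
   `U_i = ker((ℤ/p^a)ˣ → (ℤ/p^i)ˣ)` (`#U_i = p^{a-i}`, `card_ker_unitsMap`) the `p^v`-power map sends
   `U_j` onto `U_{j+v}` for `j ≥ 2` (`exists_mem_ker_pow_eq`, by counting, its kernel lying in
   `U_{a-v}` by the lifting-the-exponent lemma `modEq_one_of_pow_prime_pow_modEq_one`), prime-to-`p`
   roots exist in the `p`-group `U_1` (`exists_pow_eq_of_coprime_of_modEq_one`), and the Chinese
   remainder theorem glues with `1` modulo `p - 1`.
3. *The family.* For an exceptional primitive `ψ` of conductor `p^m` the sub-coset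
   `ψ⟨ψ^r⟩ = {ψ^{1+rj}}`, `r = p^e (p-1)` (section `Coset` of `RohrlichNonvanishingProofs`), consists
   of primitive characters of the parity of `ψ`, its character sum is supported on
   `{z : ψ(z)^r = 1} ⊆ {z : z^{2(p-1)} ≡ 1 (mod p^{m-e})}` (`castHom_pow_eq_one_of_apply_pow_eq_one_offset`,
   from the case `e = 1` and lifting the exponent), and the inverses of its members are the
   admissible conjugates `(ψ⁻¹)^{1+rj}` of `ψ⁻¹`, whose symbol sums all vanish by 1–2 and Birch's
   formula.
4. *First moment with offset `e`* (`exists_forall_family_exists_twistedSymbolSum_ne_zero_offset` and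
   sections `FamilyOffset`, `FinalOffset`): the sparse-family estimates of `RohrlichNonvanishingProofs`
   with `p^{m-1}` replaced by `p^{m-e}` (constants `4p² ↦ 4p^{e+1}`, `p^{aθ} ↦ p^{eaθ}`); for
   `m ≥ m₀(f, p)` some member of any such family has non-zero symbol sum — contradiction. So the
   exceptional `ψ` have conductor `p^m`, `m < m₀`.

## Main statements

* `int_prime_pow_add_dvd_pow_sub_one`, `pow_prime_pow_modEq_one`, `modEq_one_of_pow_prime_pow_modEq_one`
  (lifting the exponent for `k ≡ 1`); `mem_ker_unitsMap_iff`, `card_ker_unitsMap`,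
  `exists_mem_ker_pow_eq`, `exists_pow_eq_of_coprime_of_modEq_one`, `exists_units_pow_eq_of_modEq_one`
  (the groups `U_i`);
* `sum_pow_apply_mul_eq_zero_of_aeval_minpoly`, `aeval_pow_mul_minpoly_eq_zero`,
  `aeval_pow_factorial_minpoly_eq_zero`, `aeval_pow_minpoly_eq_zero_of_modEq_one` (Galois over `K`);
* `twistedSymbolSum_pow_eq_zero_of_modEq_one` (Rohrlich §1 for every newform);
* `card_support_sum_le_offset`, `norm_sum_mul_gaussSum_sq_le_of_support_offset`,
  `norm_dampedTwist_sum_sub_le_of_support_offset`, `norm_dampedTwist_dual_le_of_support_offset`,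
  `exists_forall_family_exists_twistedSymbolSum_ne_zero_offset` (analysis with offset `e`);
* `castHom_pow_eq_one_of_apply_pow_eq_one_offset` (support lemma);
* `Rohrlich1984_primePow_of_coeffBound`, `Rohrlich1984_nonvanishing_twists.primePow_of_coeffBound`.

## References

* D. E. Rohrlich, *On `L`-functions of elliptic curves and cyclotomic towers*, Invent. Math. 75
  (1984), 409–423: Theorem (p. 409), §1 (Shimura's theorem and Galois conjugation), §§2–4.
* G. Shimura, *On the periods of modular forms*, Math. Ann. 229 (1977), 211–221, Thm. 1.
* P. Deligne, *La conjecture de Weil. I*, Publ. Math. IHÉS 43 (1974), Thm. 8.2 (the coefficient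
  bound assumed in `Rohrlich1984_primePow_of_coeffBound`).
* L. C. Washington, *Introduction to cyclotomic fields*, GTM 83, §7.2 (structure of `(ℤ/p^a)ˣ`).
-/

noncomputable section

open scoped BigOperators Real IntermediateField
open Finset Filter Topology Polynomial

namespace Literature.NumberTheory.EllipticCurves


/-! ### Congruences modulo prime powers: lifting `k ≡ 1 (mod p^c)` along `p`-power maps -/

section PrimePowCongruences

variable {p : ℕ} [hp : Fact p.Prime]

omit hp in
/-- `p^c ∣ a - 1` with `c ≥ 1` implies `p^{c+j} ∣ a^{p^j} - 1` (binomial theorem / the easy half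
of the lifting-the-exponent lemma; no primality needed). [folklore] -/
theorem int_prime_pow_add_dvd_pow_sub_one {a : ℤ} {c : ℕ} (hc : c ≠ 0)
    (h : (p : ℤ) ^ c ∣ a - 1) (j : ℕ) : (p : ℤ) ^ (c + j) ∣ a ^ p ^ j - 1 := by
  induction j with
  | zero => simpa using h
  | succ j ih =>
    set b : ℤ := a ^ p ^ j with hb
    have hp1 : (p : ℤ) ∣ b - 1 := (dvd_pow_self (p : ℤ) (by omega : c + j ≠ 0)).trans ih
    have h3 : (p : ℤ) ∣ ∑ i ∈ range p, b ^ i * 1 ^ (p - 1 - i) :=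
      dvd_geom_sum₂_self (by simpa using hp1)
    have h4 := mul_dvd_mul h3 ih
    rw [geom_sum₂_mul, one_pow] at h4
    have hab : a ^ p ^ (j + 1) = b ^ p := by rw [pow_succ, pow_mul]
    rw [hab, show c + (j + 1) = (c + j) + 1 by omega, pow_succ, mul_comm]
    exact h4

/-- `k ≡ 1 (mod p^c)` with `c ≥ 1` implies `k^{p^j} ≡ 1 (mod p^{c+j})`. [folklore] -/
theorem pow_prime_pow_modEq_one {k c : ℕ} (hc : c ≠ 0) (h : k ≡ 1 [MOD p ^ c]) (j : ℕ) :
    k ^ p ^ j ≡ 1 [MOD p ^ (c + j)] := by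
  rcases Nat.eq_zero_or_pos k with rfl | hk
  · -- `0 ≡ 1 (mod p^c)` forces `p^c = 1`, impossible
    exfalso
    have h1 : p ^ c ∣ 1 := (Nat.modEq_iff_dvd' (Nat.zero_le 1)).mp h
    have h2 : p ^ c = 1 := Nat.dvd_one.mp h1
    rcases pow_eq_one_iff.mp h2 with h3 | h3
    · exact hp.out.one_lt.ne' h3
    · exact hc h3
  have hk1 : (1 : ℕ) ≤ k := hk
  have hdvd : ((p ^ c : ℕ) : ℤ) ∣ (k : ℤ) - 1 := by
    rw [← Nat.cast_one, ← Nat.cast_sub hk1]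
    exact Int.natCast_dvd_natCast.mpr ((Nat.modEq_iff_dvd' hk1).mp h.symm)
  have h2 := int_prime_pow_add_dvd_pow_sub_one (p := p) (a := (k : ℤ)) hc (by exact_mod_cast hdvd) j
  have hk1' : 1 ≤ k ^ p ^ j := Nat.one_le_pow _ _ hk
  refine ((Nat.modEq_iff_dvd' hk1').mpr ?_).symm
  rw [← Int.natCast_dvd_natCast]
  push_cast [Nat.cast_sub hk1']
  exact h2

/-- The hard half of lifting the exponent: if `k ≡ 1 (mod p)` (and `k ≡ 1 (mod 4)` when `p = 2`)
and `k^{p^j} ≡ 1 (mod p^{c+j})`, then `k ≡ 1 (mod p^c)` (Mathlib's LTE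
`padicValNat.pow_sub_pow`, `padicValNat.pow_two_sub_pow`). [folklore] -/
theorem modEq_one_of_pow_prime_pow_modEq_one {k c j : ℕ} (hk1 : k ≡ 1 [MOD p])
    (hk4 : p = 2 → k ≡ 1 [MOD 4]) (h : k ^ p ^ j ≡ 1 [MOD p ^ (c + j)]) : k ≡ 1 [MOD p ^ c] := by
  rcases Nat.lt_or_ge 1 k with hk | hk
  · -- `1 < k`
    have hkp : ¬ p ∣ k := by
      intro hpk
      have h1 : p ∣ k - 1 := (Nat.modEq_iff_dvd' hk.le).mp hk1.symm
      have : p ∣ k - (k - 1) := Nat.dvd_sub hpk h1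
      rw [Nat.sub_sub_self hk.le] at this
      exact hp.out.one_lt.ne' (Nat.dvd_one.mp this)
    have hsub : p ∣ k - 1 := (Nat.modEq_iff_dvd' hk.le).mp hk1.symm
    have hkj0 : k ^ p ^ j - 1 ≠ 0 := by
      have : 1 < k ^ p ^ j := Nat.one_lt_pow (pow_ne_zero _ hp.out.ne_zero) hk
      omega
    have hv : c + j ≤ padicValNat p (k ^ p ^ j - 1) :=
      (padicValNat_dvd_iff_le hkj0).mp ((Nat.modEq_iff_dvd' (Nat.one_le_pow _ _ (by omega))).mp h.symm)
    have hk10 : k - 1 ≠ 0 := by omega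
    suffices hc : c ≤ padicValNat p (k - 1) from
      ((Nat.modEq_iff_dvd' hk.le).mpr ((padicValNat_dvd_iff_le hk10).mpr hc)).symm
    rcases hp.out.eq_two_or_odd' with rfl | hodd
    · -- `p = 2`
      rcases Nat.eq_zero_or_pos j with rfl | hj
      · simpa using hv
      have h4 : k ≡ 1 [MOD 4] := hk4 rfl
      have hplus : padicValNat 2 (k + 1) = 1 := by
        have h2 : 2 ∣ k + 1 := by
          have : 4 ∣ k - 1 := (Nat.modEq_iff_dvd' hk.le).mp h4.symm
          omega
        have h4n : ¬ 4 ∣ k + 1 := by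
          have : 4 ∣ k - 1 := (Nat.modEq_iff_dvd' hk.le).mp h4.symm
          omega
        apply le_antisymm
        · by_contra hlt
          push Not at hlt
          have : 2 ^ 2 ∣ k + 1 := (padicValNat_dvd_iff_le (by omega)).mpr hlt
          exact h4n (by simpa using this)
        · exact (padicValNat_dvd_iff_le (by omega)).mp (by simpa using h2)
      have hlte := padicValNat.pow_two_sub_pow hk (by simpa using hsub) (by simpa using hkp)
        (n := 2 ^ j) (pow_ne_zero _ two_ne_zero) (by
          rw [Nat.even_pow]; exact ⟨even_two, hj.ne'⟩)
      rw [one_pow, hplus, padicValNat.prime_pow] at hlte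
      omega
    · have hlte := padicValNat.pow_sub_pow hodd hk hsub hkp (n := p ^ j)
        (pow_ne_zero _ hp.out.ne_zero)
      rw [one_pow, padicValNat.prime_pow] at hlte
      omega
  · -- `k ≤ 1`
    rcases Nat.eq_zero_or_pos k with rfl | hk0
    · exfalso
      have h1 : p ∣ 1 := (Nat.modEq_iff_dvd' (Nat.zero_le 1)).mp hk1
      exact hp.out.one_lt.ne' (Nat.dvd_one.mp h1)
    · have : k = 1 := le_antisymm hk hk0
      subst this
      exact Nat.ModEq.refl 1

end PrimePowCongruences

/-! ### The groups `U_i = ker((ℤ/p^a)ˣ → (ℤ/p^i)ˣ)`: cardinality and `p`-power maps -/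

section UnitGroups

variable {p : ℕ} [hp : Fact p.Prime] {a : ℕ}

/-- Membership in `U_i`: `u ≡ 1 (mod p^i)` for the standard representative of `u`. [folklore] -/
theorem mem_ker_unitsMap_iff {i : ℕ} (hi : i ≤ a) (u : (ZMod (p ^ a))ˣ) :
    u ∈ (ZMod.unitsMap (pow_dvd_pow p hi)).ker ↔ (u : ZMod (p ^ a)).val ≡ 1 [MOD p ^ i] := by
  haveI : NeZero (p ^ a) := ⟨pow_ne_zero _ hp.out.ne_zero⟩
  rw [MonoidHom.mem_ker, Units.ext_iff, ZMod.unitsMap_val, Units.val_one, ZMod.cast_eq_val,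
    show (1 : ZMod (p ^ i)) = ((1 : ℕ) : ZMod (p ^ i)) by rw [Nat.cast_one],
    ZMod.natCast_eq_natCast_iff]

/-- A unit `u` mod `p^a` equals the class of its representative, so `u^E` is the class of
`(val u)^E`. [folklore] -/
theorem units_pow_eq_natCast_pow (u : (ZMod (p ^ a))ˣ) (E : ℕ) :
    ((u ^ E : (ZMod (p ^ a))ˣ) : ZMod (p ^ a)) = (((u : ZMod (p ^ a)).val ^ E : ℕ) : ZMod (p ^ a)) := by
  haveI : NeZero (p ^ a) := ⟨pow_ne_zero _ hp.out.ne_zero⟩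
  rw [Units.val_pow_eq_pow_val, Nat.cast_pow, ZMod.natCast_zmod_val]

/-- `#U_i = p^{a-i}` for `1 ≤ i ≤ a` (`(ℤ/p^a)ˣ → (ℤ/p^i)ˣ` is onto and `#(ℤ/p^n)ˣ = p^{n-1}(p-1)`).
[folklore] -/
theorem card_ker_unitsMap {i : ℕ} (hi1 : 1 ≤ i) (hia : i ≤ a) :
    Nat.card (ZMod.unitsMap (pow_dvd_pow p hia)).ker = p ^ (a - i) := by
  haveI : NeZero (p ^ a) := ⟨pow_ne_zero _ hp.out.ne_zero⟩
  set φ := ZMod.unitsMap (pow_dvd_pow p hia) with hφ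
  have h1 : Nat.card φ.ker * φ.ker.index = Nat.card (ZMod (p ^ a))ˣ := φ.ker.card_mul_index
  have h2 : φ.ker.index = Nat.card (ZMod (p ^ i))ˣ := by
    rw [Subgroup.index_ker, MonoidHom.range_eq_top.mpr (ZMod.unitsMap_surjective _),
      Subgroup.card_top]
  rw [h2, Nat.card_eq_fintype_card (α := (ZMod (p ^ i))ˣ),
    Nat.card_eq_fintype_card (α := (ZMod (p ^ a))ˣ),
    ZMod.card_units_eq_totient, ZMod.card_units_eq_totient,
    Nat.totient_prime_pow hp.out (by omega), Nat.totient_prime_pow hp.out (by omega)] at h1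
  have hp1 : 0 < p - 1 := by have := hp.out.two_le; omega
  have h3 : Nat.card φ.ker * p ^ (i - 1) = p ^ (a - 1) := by
    rw [← mul_assoc] at h1
    exact Nat.eq_of_mul_eq_mul_right hp1 h1
  have hpow : p ^ (a - 1) = p ^ (a - i) * p ^ (i - 1) := by
    rw [← pow_add]; congr 1; omega
  rw [hpow] at h3
  exact Nat.eq_of_mul_eq_mul_right (pow_pos hp.out.pos _) h3

/-- **`p^v`-th roots in `U_j`**: for `j ≥ 2` and `j + v ≤ a`, every `x ∈ U_{j+v}` is `u^{p^v}` for
some `u ∈ U_j` — the `p^v`-power map `U_j → U_{j+v}` has kernel inside `U_{a-v}` (lifting the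
exponent), of order `≤ p^v = #U_j / #U_{j+v}`, hence is onto. [folklore] -/
theorem exists_mem_ker_pow_eq {j v : ℕ} (hj : 2 ≤ j) (hjva : j + v ≤ a)
    {x : (ZMod (p ^ a))ˣ} (hx : x ∈ (ZMod.unitsMap (pow_dvd_pow p hjva)).ker) :
    ∃ u : (ZMod (p ^ a))ˣ,
      u ∈ (ZMod.unitsMap (pow_dvd_pow p ((Nat.le_add_right j v).trans hjva))).ker ∧ u ^ p ^ v = x := by
  haveI : NeZero (p ^ a) := ⟨pow_ne_zero _ hp.out.ne_zero⟩
  have hja : j ≤ a := (Nat.le_add_right j v).trans hjva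
  have hav : a - v ≤ a := Nat.sub_le a v
  set Uj := (ZMod.unitsMap (pow_dvd_pow p hja)).ker with hUj
  set Ujv := (ZMod.unitsMap (pow_dvd_pow p hjva)).ker with hUjv
  set Uav := (ZMod.unitsMap (pow_dvd_pow p hav)).ker with hUav
  -- the `p^v`-power map on `U_j`
  set ψ : Uj →* (ZMod (p ^ a))ˣ := (powMonoidHom (p ^ v)).comp Uj.subtype with hψ
  have hψ_apply : ∀ u : Uj, ψ u = (u : (ZMod (p ^ a))ˣ) ^ p ^ v := fun u ↦ rfl
  -- its image lies in `U_{j+v}`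
  have hrange : ψ.range ≤ Ujv := by
    rintro _ ⟨u, rfl⟩
    rw [hψ_apply, hUjv, mem_ker_unitsMap_iff hjva, units_pow_eq_natCast_pow, ZMod.val_natCast]
    have hu : ((u : (ZMod (p ^ a))ˣ) : ZMod (p ^ a)).val ≡ 1 [MOD p ^ j] :=
      (mem_ker_unitsMap_iff hja _).mp u.2
    have h := pow_prime_pow_modEq_one (p := p) (by omega : j ≠ 0) hu v
    exact ((Nat.mod_modEq _ _).of_dvd (pow_dvd_pow p hjva)).trans h
  -- its kernel lies in `U_{a-v}`
  have hker : ψ.ker.map Uj.subtype ≤ Uav := by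
    rintro _ ⟨u, hu, rfl⟩
    rw [SetLike.mem_coe, MonoidHom.mem_ker, hψ_apply] at hu
    change (u : (ZMod (p ^ a))ˣ) ∈ Uav
    rw [hUav, mem_ker_unitsMap_iff hav]
    have huj : ((u : (ZMod (p ^ a))ˣ) : ZMod (p ^ a)).val ≡ 1 [MOD p ^ j] :=
      (mem_ker_unitsMap_iff hja _).mp u.2
    have hk1 : ((u : (ZMod (p ^ a))ˣ) : ZMod (p ^ a)).val ≡ 1 [MOD p] :=
      huj.of_dvd (dvd_pow_self p (by omega))
    have hk4 : p = 2 → ((u : (ZMod (p ^ a))ˣ) : ZMod (p ^ a)).val ≡ 1 [MOD 4] := by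
      rintro rfl
      exact huj.of_dvd ⟨2 ^ (j - 2), by rw [show (4 : ℕ) = 2 ^ 2 by norm_num, ← pow_add]; congr 1; omega⟩
    have hpow : ((u : (ZMod (p ^ a))ˣ) : ZMod (p ^ a)).val ^ p ^ v ≡ 1 [MOD p ^ (a - v + v)] := by
      rw [Nat.sub_add_cancel (by omega : v ≤ a)]
      have h1 : ((((u : (ZMod (p ^ a))ˣ) : ZMod (p ^ a)).val ^ p ^ v : ℕ) : ZMod (p ^ a)) = 1 := by
        rw [← units_pow_eq_natCast_pow, hu, Units.val_one]
      rw [show (1 : ZMod (p ^ a)) = ((1 : ℕ) : ZMod (p ^ a)) by rw [Nat.cast_one],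
        ZMod.natCast_eq_natCast_iff] at h1
      exact h1
    exact modEq_one_of_pow_prime_pow_modEq_one hk1 hk4 hpow
  -- count
  have hcardj : Nat.card Uj = p ^ (a - j) := card_ker_unitsMap (by omega) hja
  have hcardjv : Nat.card Ujv = p ^ (a - (j + v)) := card_ker_unitsMap (by omega) hjva
  have hcardav : Nat.card Uav = p ^ (a - (a - v)) := card_ker_unitsMap (by omega) hav
  have hkercard : Nat.card ψ.ker ≤ p ^ v := by
    have h1 : Nat.card (ψ.ker.map Uj.subtype) = Nat.card ψ.ker :=
      Subgroup.card_map_of_injective Uj.subtype_injective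
    have h2 := Subgroup.card_le_of_le hker
    rw [h1, hcardav, show a - (a - v) = v by omega] at h2
    exact h2
  have hrangecard : Nat.card Ujv ≤ Nat.card ψ.range := by
    have h1 : Nat.card ψ.ker * ψ.ker.index = Nat.card Uj := ψ.ker.card_mul_index
    rw [Subgroup.index_ker, hcardj] at h1
    rw [hcardjv]
    have hpos : 0 < Nat.card ψ.ker := Nat.card_pos
    have h3 : p ^ (a - j) ≤ p ^ v * Nat.card ψ.range := by
      rw [← h1]; exact Nat.mul_le_mul_right _ hkercard
    have h4 : p ^ (a - j) = p ^ v * p ^ (a - (j + v)) := by rw [← pow_add]; congr 1; omega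
    rw [h4] at h3
    exact Nat.le_of_mul_le_mul_left h3 (pow_pos hp.out.pos _)
  have heq : ψ.range = Ujv := Subgroup.eq_of_le_of_card_ge hrange hrangecard
  have hxr : x ∈ ψ.range := by rw [heq]; exact hx
  obtain ⟨u, hu⟩ := hxr
  exact ⟨u, u.2, by rw [← hψ_apply, hu]⟩

/-- **Prime-to-`p` roots in `U_1`**: if `u ≡ 1 (mod p)` and `gcd(w, p) = 1` then `u = t^w` for some
`t ≡ 1 (mod p)` (`u` has `p`-power order). [folklore] -/
theorem exists_pow_eq_of_coprime_of_modEq_one (ha : a ≠ 0) {w : ℕ} (hw : w.Coprime p)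
    {u : (ZMod (p ^ a))ˣ} (hu : (u : ZMod (p ^ a)).val ≡ 1 [MOD p]) :
    ∃ t : (ZMod (p ^ a))ˣ, (t : ZMod (p ^ a)).val ≡ 1 [MOD p] ∧ t ^ w = u := by
  haveI : NeZero (p ^ a) := ⟨pow_ne_zero _ hp.out.ne_zero⟩
  -- `u^{p^{a-1}} = 1`
  have hord : orderOf u ∣ p ^ (a - 1) := by
    apply orderOf_dvd_of_pow_eq_one
    have h := pow_prime_pow_modEq_one (p := p) one_ne_zero (by simpa using hu) (a - 1)
    rw [show 1 + (a - 1) = a by omega] at h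
    apply Units.ext
    rw [units_pow_eq_natCast_pow, Units.val_one,
      show (1 : ZMod (p ^ a)) = ((1 : ℕ) : ZMod (p ^ a)) by rw [Nat.cast_one],
      ZMod.natCast_eq_natCast_iff]
    exact h
  have hcop : w.Coprime (orderOf u) := (hw.pow_right (a - 1)).coprime_dvd_right hord
  obtain ⟨m, hm⟩ := exists_pow_eq_self_of_coprime hcop
  refine ⟨u ^ m, ?_, by rw [← pow_mul, mul_comm, pow_mul, hm]⟩
  rw [units_pow_eq_natCast_pow, ZMod.val_natCast]
  have h1 : (u : ZMod (p ^ a)).val ^ m ≡ 1 [MOD p] := by simpa using hu.pow m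
  exact ((Nat.mod_modEq _ _).of_dvd (dvd_pow_self p ha)).trans h1

/-- **`E`-th roots of `k ≡ 1 (mod p^e (p-1))` in `(ℤ/p^a(p-1))ˣ`.** If `p^{v_p(E)+2} ∣ p^e`, i.e.
`e ≥ v_p(E) + 2`, then every `k ≡ 1 (mod p^e (p-1))` prime to `p^a (p-1)` is an `E`-th power in
`(ℤ/p^a (p-1))ˣ`: modulo `p^a` extract a `p^{v_p(E)}`-th root in `U_{e - v_p(E)}`
(`exists_mem_ker_pow_eq`) and then a prime-to-`p` root (`exists_pow_eq_of_coprime_of_modEq_one`),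
and glue with `1` modulo `p - 1` by the Chinese remainder theorem. [folklore] -/
theorem exists_units_pow_eq_of_modEq_one {e E : ℕ} (hE : E ≠ 0) (he : padicValNat p E + 2 ≤ e)
    {k : ℕ} (hk : k ≡ 1 [MOD p ^ e * (p - 1)]) (hkD : k.Coprime (p ^ a * (p - 1))) :
    ∃ g : (ZMod (p ^ a * (p - 1)))ˣ, g ^ E = ZMod.unitOfCoprime k hkD := by
  haveI : NeZero (p ^ a) := ⟨pow_ne_zero _ hp.out.ne_zero⟩
  have hp2 := hp.out.two_le
  set v : ℕ := padicValNat p E with hv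
  obtain ⟨w, hEw⟩ : p ^ v ∣ E := pow_padicValNat_dvd
  have hwp : w.Coprime p := by
    rw [Nat.coprime_comm, hp.out.coprime_iff_not_dvd]
    rintro ⟨c, rfl⟩
    have : p ^ (v + 1) ∣ E := ⟨c, by rw [hEw]; ring⟩
    exact pow_succ_padicValNat_not_dvd hE this
  have hke : k ≡ 1 [MOD p ^ e] := hk.of_dvd (dvd_mul_right _ _)
  have hkp1 : k ≡ 1 [MOD p - 1] := hk.of_dvd (dvd_mul_left _ _)
  have hka : k.Coprime (p ^ a) := hkD.coprime_dvd_right (dvd_mul_right _ _)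
  -- an `E`-th root modulo `p^a`
  obtain ⟨t, ht⟩ : ∃ t : (ZMod (p ^ a))ˣ, t ^ E = ZMod.unitOfCoprime k hka := by
    rcases Nat.lt_or_ge e a with hea | hea
    · -- `e < a`: `k ∈ U_e = U_{(e-v)+v}`
      have hx : ZMod.unitOfCoprime k hka ∈ (ZMod.unitsMap (pow_dvd_pow p hea.le)).ker := by
        rw [mem_ker_unitsMap_iff hea.le, ZMod.coe_unitOfCoprime, ZMod.val_natCast]
        exact ((Nat.mod_modEq _ _).of_dvd (pow_dvd_pow p hea.le)).trans hke
      have hsplit : (e - v) + v = e := by omega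
      have hjva : (e - v) + v ≤ a := by omega
      have hx' : ZMod.unitOfCoprime k hka ∈ (ZMod.unitsMap (pow_dvd_pow p hjva)).ker := by
        convert hx using 3 <;> rw [hsplit]
      obtain ⟨u, hu, hux⟩ := exists_mem_ker_pow_eq (by omega : 2 ≤ e - v) hjva hx'
      have hu1 : (u : ZMod (p ^ a)).val ≡ 1 [MOD p] :=
        ((mem_ker_unitsMap_iff ((Nat.le_add_right _ _).trans hjva) u).mp hu).of_dvd
          (dvd_pow_self p (by omega))
      obtain ⟨t, -, htu⟩ := exists_pow_eq_of_coprime_of_modEq_one (by omega) hwp hu1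
      refine ⟨t, ?_⟩
      rw [hEw, mul_comm, pow_mul, htu, hux]
    · -- `a ≤ e`: `k ≡ 1 (mod p^a)`
      refine ⟨1, ?_⟩
      rw [one_pow]
      apply Units.ext
      rw [Units.val_one, ZMod.coe_unitOfCoprime,
        show (1 : ZMod (p ^ a)) = ((1 : ℕ) : ZMod (p ^ a)) by rw [Nat.cast_one],
        ZMod.natCast_eq_natCast_iff]
      exact (hke.of_dvd (pow_dvd_pow p hea)).symm
  -- glue with `1` modulo `p - 1`
  have hco : (p ^ a).Coprime (p - 1) := by
    refine Nat.Coprime.pow_left a ?_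
    have : (p - 1 + 1).Coprime (p - 1) := by
      rw [Nat.coprime_self_add_left]; exact Nat.coprime_one_left _
    rwa [Nat.sub_add_cancel (by omega)] at this
  set z := Nat.chineseRemainder hco (t : ZMod (p ^ a)).val 1 with hz
  have hz1 : (z : ℕ) ≡ (t : ZMod (p ^ a)).val [MOD p ^ a] := z.2.1
  have hz2 : (z : ℕ) ≡ 1 [MOD p - 1] := z.2.2
  have hzcop : (z : ℕ).Coprime (p ^ a * (p - 1)) := by
    refine Nat.Coprime.mul_right ?_ ?_
    · rw [Nat.Coprime, hz1.gcd_eq]; exact ZMod.val_coe_unit_coprime t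
    · rw [Nat.Coprime, hz2.gcd_eq]; exact Nat.gcd_one_left _
  refine ⟨ZMod.unitOfCoprime z hzcop, ?_⟩
  apply Units.ext
  rw [Units.val_pow_eq_pow_val, ZMod.coe_unitOfCoprime, ZMod.coe_unitOfCoprime, ← Nat.cast_pow,
    ZMod.natCast_eq_natCast_iff, ← Nat.modEq_and_modEq_iff_modEq_mul hco]
  constructor
  · -- modulo `p^a`: `z^E ≡ t^E ≡ k`
    have h1 : (((t : ZMod (p ^ a)).val ^ E : ℕ) : ZMod (p ^ a)) = (k : ZMod (p ^ a)) := by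
      rw [← units_pow_eq_natCast_pow, ht, ZMod.coe_unitOfCoprime]
    rw [ZMod.natCast_eq_natCast_iff] at h1
    exact (hz1.pow E).trans h1
  · -- modulo `p - 1`: `z^E ≡ 1 ≡ k`
    have h1 : (z : ℕ) ^ E ≡ 1 [MOD p - 1] := by simpa using hz2.pow E
    exact h1.trans hkp1.symm

end UnitGroups



/-! ### Galois conjugation over a coefficient field `K` -/

section GaloisK

variable (K : IntermediateField ℚ ℂ)

/-- **Galois conjugation over `K` of a vanishing `K`-rational relation among character values.**
Let `χ` be a Dirichlet character with `χ^D = 1`, `ζ = e^{2πi/D}`, and `∑_a χ(a) q_a = 0` with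
`q_a ∈ K`. Then `∑_a χ^k(a) q_a = 0` for every `k` such that `ζ^k` is a root of the minimal
polynomial of `ζ` over `K` (a `K`-conjugate of `ζ`): the values `χ(a) = ζ^{e_a}` make
`P = ∑ q_a X^{e_a} ∈ K[X]` vanish at `ζ`, so `minpoly_K ζ ∣ P` and `P(ζ^k) = 0` (Rohrlich 1984, §1:
`L(1, f, χ) = 0 ⟹ L(1, f, χ^σ) = 0` for `σ ∈ Gal(ℚ̄/K_f)`; the case `K = ℚ` is
`sum_pow_apply_mul_eq_zero_of_coprime`). [folklore] -/
theorem sum_pow_apply_mul_eq_zero_of_aeval_minpoly {M : ℕ} [NeZero M] (χ : DirichletCharacter ℂ M)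
    {D : ℕ} [NeZero D] (hχD : χ ^ D = 1) (q : ZMod M → ℂ) (hq : ∀ a, q a ∈ K)
    (h : ∑ a : ZMod M, χ a * q a = 0) {k : ℕ}
    (hk : aeval (Complex.exp (2 * Real.pi * Complex.I / D) ^ k)
      (minpoly K (Complex.exp (2 * Real.pi * Complex.I / D))) = 0) :
    ∑ a : ZMod M, (χ ^ k) a * q a = 0 := by
  classical
  set ζ : ℂ := Complex.exp (2 * Real.pi * Complex.I / D) with hζ
  have hζprim : IsPrimitiveRoot ζ D := Complex.isPrimitiveRoot_exp D (NeZero.ne D)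
  -- each unit value is a power of `ζ`
  have hval : ∀ u : (ZMod M)ˣ, ∃ i < D, ζ ^ i = χ u := fun u ↦ by
    refine hζprim.eq_pow_of_pow_eq_one ?_
    rw [← MulChar.pow_apply_coe, hχD, MulChar.one_apply_coe]
  choose e _he_lt he using hval
  -- the polynomial `∑ q_u X^{e_u} ∈ K[X]`
  set P : K[X] := ∑ u : (ZMod M)ˣ, C (⟨q u, hq u⟩ : K) * X ^ (e u) with hP
  have haeval : ∀ z : ℂ, aeval z P = ∑ u : (ZMod M)ˣ, q u * z ^ (e u) := fun z ↦ by
    simp only [hP, map_sum, map_mul, aeval_C, map_pow, aeval_X]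
    rfl
  have hunits : ∀ ψ : DirichletCharacter ℂ M,
      ∑ a : ZMod M, ψ a * q a = ∑ u : (ZMod M)ˣ, ψ u * q u := fun ψ ↦
    ModularForms.sum_eq_sum_units (m := M) (fun a ↦ ψ a * q a)
      (fun x hx ↦ by rw [MulChar.map_nonunit ψ hx, zero_mul])
  have hPζ : aeval ζ P = 0 := by
    rw [haeval, ← h, hunits]
    exact Finset.sum_congr rfl fun u _ ↦ by rw [he u, mul_comm]
  have hmin : minpoly K ζ ∣ P := minpoly.dvd K ζ hPζ
  have hPk : aeval (ζ ^ k) P = 0 := by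
    obtain ⟨R, hR⟩ := hmin
    rw [hR, map_mul, hk, zero_mul]
  rw [hunits]
  calc ∑ u : (ZMod M)ˣ, (χ ^ k) u * q u = aeval (ζ ^ k) P := by
        rw [haeval]
        refine Finset.sum_congr rfl fun u _ ↦ ?_
        rw [MulChar.pow_apply_coe, ← he u, ← pow_mul, mul_comm (e u) k, pow_mul, mul_comm]
    _ = 0 := hPk

/-- The `K`-conjugacy of `ζ^k` to `ζ = e^{2πi/D}` only depends on `k mod D`. [folklore] -/
theorem aeval_pow_minpoly_eq_of_modEq {D : ℕ} [NeZero D] {k l : ℕ} (hkl : k ≡ l [MOD D]) :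
    aeval (Complex.exp (2 * Real.pi * Complex.I / D) ^ k)
        (minpoly K (Complex.exp (2 * Real.pi * Complex.I / D))) =
      aeval (Complex.exp (2 * Real.pi * Complex.I / D) ^ l)
        (minpoly K (Complex.exp (2 * Real.pi * Complex.I / D))) := by
  set ζ : ℂ := Complex.exp (2 * Real.pi * Complex.I / D) with hζdef
  have hζ : IsPrimitiveRoot ζ D := Complex.isPrimitiveRoot_exp D (NeZero.ne D)
  have hkl' : k % D = l % D := hkl
  have hpow : ζ ^ k = ζ ^ l := by
    rw [← Nat.mod_add_div k D, ← Nat.mod_add_div l D, pow_add, pow_add, pow_mul, pow_mul,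
      hζ.pow_eq_one, one_pow, one_pow, hkl']
  rw [hpow]

/-- **The `K`-conjugates `ζ^k` of `ζ = e^{2πi/D}` are closed under multiplication of exponents**:
if `μ = minpoly_K ζ` vanishes at `ζ^a` and at `ζ^b` then at `ζ^{ab}` — `μ(X^b)` vanishes at `ζ`,
so `μ ∣ μ(X^b)`, which therefore vanishes at `ζ^a` (the argument proving the irreducibility of
cyclotomic polynomials). [folklore] -/
theorem aeval_pow_mul_minpoly_eq_zero {D : ℕ} {a b : ℕ}
    (ha : aeval (Complex.exp (2 * Real.pi * Complex.I / D) ^ a)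
      (minpoly K (Complex.exp (2 * Real.pi * Complex.I / D))) = 0)
    (hb : aeval (Complex.exp (2 * Real.pi * Complex.I / D) ^ b)
      (minpoly K (Complex.exp (2 * Real.pi * Complex.I / D))) = 0) :
    aeval (Complex.exp (2 * Real.pi * Complex.I / D) ^ (a * b))
      (minpoly K (Complex.exp (2 * Real.pi * Complex.I / D))) = 0 := by
  set ζ : ℂ := Complex.exp (2 * Real.pi * Complex.I / D) with hζ
  set μ : K[X] := minpoly K ζ with hμ
  set ν : K[X] := μ.comp (X ^ b) with hν
  have hνζ : aeval ζ ν = 0 := by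
    rw [hν, aeval_comp, map_pow, aeval_X, hb]
  have hdvd : μ ∣ ν := minpoly.dvd K ζ hνζ
  have hνa : aeval (ζ ^ a) ν = 0 := by
    obtain ⟨R, hR⟩ := hdvd
    rw [hR, map_mul, ha, zero_mul]
  rwa [hν, aeval_comp, map_pow, aeval_X, ← pow_mul] at hνa

variable [FiniteDimensional ℚ K]

/-- **The exponents `k` with `ζ^k` a `K`-conjugate of `ζ = e^{2πi/D}` form a subgroup of
`(ℤ/D)ˣ` of index at most `[K : ℚ]`, so every `[K : ℚ]!`-th power is one of them.** The set of
such `k` is closed under multiplication (`aeval_pow_mul_minpoly_eq_zero`) and contains the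
exponents of all `deg μ = [K(ζ) : K] ≥ φ(D)/[K : ℚ]` roots of `μ = minpoly_K ζ` (a separable
divisor of `Φ_D`, whose roots are primitive `D`-th roots of unity); a subgroup of index `≤ n`
contains all `n!`-th powers. Stated for a unit `u` mod `D`: `ζ^{(u^{n!})}` is a root of `μ`,
`n = [K : ℚ]`. [folklore] -/
theorem aeval_pow_factorial_minpoly_eq_zero {D : ℕ} [NeZero D] (u : (ZMod D)ˣ) :
    aeval (Complex.exp (2 * Real.pi * Complex.I / D) ^
        ((u ^ (Module.finrank ℚ K).factorial : (ZMod D)ˣ) : ZMod D).val)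
      (minpoly K (Complex.exp (2 * Real.pi * Complex.I / D))) = 0 := by
  classical
  set n : ℕ := Module.finrank ℚ K with hn
  set ζ : ℂ := Complex.exp (2 * Real.pi * Complex.I / D) with hζ
  have hD0 : 0 < D := Nat.pos_of_ne_zero (NeZero.ne D)
  have hζprim : IsPrimitiveRoot ζ D := Complex.isPrimitiveRoot_exp D (NeZero.ne D)
  set μ : K[X] := minpoly K ζ with hμ
  -- the admissible exponents as a subgroup `R` of `(ℤ/D)ˣ`
  let adm : (ZMod D)ˣ → Prop := fun w ↦ aeval (ζ ^ (w : ZMod D).val) μ = 0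
  have hadm_one : adm 1 := by
    change aeval (ζ ^ ((1 : (ZMod D)ˣ) : ZMod D).val) μ = 0
    rcases Nat.lt_or_ge 1 D with h1 | h1
    · haveI : Fact (1 < D) := ⟨h1⟩
      rw [Units.val_one, ZMod.val_one, pow_one]
      exact minpoly.aeval K ζ
    · have hD1 : D = 1 := le_antisymm h1 hD0
      have hζ1 : ζ = 1 := by
        have := hζprim.pow_eq_one
        rwa [hD1, pow_one] at this
      rw [hζ1, one_pow, ← hζ1]
      exact minpoly.aeval K ζ
  have hadm_mul : ∀ v w, adm v → adm w → adm (v * w) := by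
    intro v w hv hw
    change aeval (ζ ^ ((v * w : (ZMod D)ˣ) : ZMod D).val) μ = 0
    have hmod : ((v * w : (ZMod D)ˣ) : ZMod D).val ≡ (v : ZMod D).val * (w : ZMod D).val [MOD D] := by
      rw [Units.val_mul, ZMod.val_mul]
      exact Nat.mod_modEq _ _
    rw [aeval_pow_minpoly_eq_of_modEq K hmod]
    exact aeval_pow_mul_minpoly_eq_zero K hv hw
  have hadm_pow : ∀ v (j : ℕ), adm v → adm (v ^ j) := by
    intro v j hv
    induction j with
    | zero => rw [pow_zero]; exact hadm_one
    | succ j ih => rw [pow_succ]; exact hadm_mul _ _ ih hv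
  let R : Subgroup (ZMod D)ˣ :=
    { carrier := {w | adm w}
      mul_mem' := fun {v w} hv hw ↦ hadm_mul v w hv hw
      one_mem' := hadm_one
      inv_mem' := fun {v} hv ↦ by
        have h := hadm_pow v (orderOf v - 1) hv
        have hv1 : v ^ (orderOf v - 1) = v⁻¹ := by
          rw [eq_inv_iff_mul_eq_one, ← pow_succ, Nat.sub_add_cancel (orderOf_pos v), pow_orderOf_eq_one]
        rwa [hv1] at h }
  -- it suffices that the index of `R` is at most `n`
  suffices hidx : R.index ≤ n by
    have hidx0 : 0 < R.index := Nat.pos_of_ne_zero Subgroup.index_ne_zero_of_finite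
    have hmem : u ^ R.index ∈ R := R.pow_index_mem u
    have hdvd : R.index ∣ n.factorial := Nat.dvd_factorial hidx0 hidx
    obtain ⟨c, hc⟩ := hdvd
    have : u ^ n.factorial ∈ R := by
      rw [hc, pow_mul]
      exact R.pow_mem hmem c
    exact this
  -- `μ` divides `Φ_D`, is separable, and its roots are primitive `D`-th roots of unity
  have hint : IsIntegral K ζ := (hζprim.isIntegral hD0).tower_top
  have hμΦ : μ ∣ (cyclotomic D ℚ).map (algebraMap ℚ K) := by
    refine minpoly.dvd K ζ ?_
    rw [aeval_map_algebraMap, aeval_def, ← eval_map, map_cyclotomic, ← IsRoot.def,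
      isRoot_cyclotomic_iff]
    exact hζprim
  have hμsep : μ.Separable := by
    refine Separable.of_dvd ?_ hμΦ
    exact (separable_map _).mpr ((cyclotomic.irreducible_rat hD0).separable)
  set μC : ℂ[X] := μ.map (algebraMap K ℂ) with hμC
  have hμC0 : μC ≠ 0 := (Polynomial.map_ne_zero_iff (algebraMap K ℂ).injective).mpr
    (minpoly.ne_zero hint)
  have hsplit : μC.Splits := IsAlgClosed.splits _
  have hcardroots : μC.roots.toFinset.card = μ.natDegree := by
    rw [Multiset.toFinset_card_of_nodup (nodup_roots ((separable_map _).mpr hμsep)),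
      ← hsplit.natDegree_eq_card_roots, natDegree_map]
  have hroots_prim : ∀ z ∈ μC.roots.toFinset, z ∈ primitiveRoots D ℂ := by
    intro z hz
    rw [Multiset.mem_toFinset, mem_roots hμC0, IsRoot.def, hμC, eval_map, ← aeval_def] at hz
    have hzΦ : aeval z ((cyclotomic D ℚ).map (algebraMap ℚ K)) = 0 := by
      obtain ⟨c, hc⟩ := hμΦ
      rw [hc, map_mul, hz, zero_mul]
    rw [aeval_map_algebraMap, aeval_def, ← eval_map, map_cyclotomic, ← IsRoot.def,
      isRoot_cyclotomic_iff] at hzΦ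
    exact (mem_primitiveRoots hD0).mpr hzΦ
  -- each root is `ζ^{w}` for an admissible unit `w`
  have hroot_adm : ∀ z ∈ μC.roots.toFinset, ∃ w : (ZMod D)ˣ, w ∈ R ∧ ζ ^ (w : ZMod D).val = z := by
    intro z hz
    have hzprim := hroots_prim z hz
    rw [Multiset.mem_toFinset, mem_roots hμC0, IsRoot.def, hμC, eval_map, ← aeval_def] at hz
    rw [mem_primitiveRoots hD0] at hzprim
    obtain ⟨i, hiD, rfl⟩ := hζprim.eq_pow_of_pow_eq_one hzprim.pow_eq_one
    have hcop : i.Coprime D := (hζprim.pow_iff_coprime hD0 i).mp hzprim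
    refine ⟨ZMod.unitOfCoprime i hcop, ?_, ?_⟩
    · change aeval (ζ ^ ((ZMod.unitOfCoprime i hcop : (ZMod D)ˣ) : ZMod D).val) μ = 0
      rwa [ZMod.coe_unitOfCoprime, ZMod.val_natCast, Nat.mod_eq_of_lt hiD]
    · rw [ZMod.coe_unitOfCoprime, ZMod.val_natCast, Nat.mod_eq_of_lt hiD]
  -- hence `#R ≥ deg μ`
  have hcardR : μ.natDegree ≤ Nat.card R := by
    rw [← hcardroots]
    choose w hwR hwζ using hroot_adm
    let F : μC.roots.toFinset → R := fun z ↦ ⟨w z.1 z.2, hwR z.1 z.2⟩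
    have hF : Function.Injective F := by
      intro z₁ z₂ h
      have h' : (w z₁.1 z₁.2 : (ZMod D)ˣ) = w z₂.1 z₂.2 := congrArg Subtype.val h
      apply Subtype.ext
      rw [← hwζ z₁.1 z₁.2, ← hwζ z₂.1 z₂.2, h']
    have h := Fintype.card_le_of_injective F hF
    rw [Fintype.card_coe] at h
    rwa [Nat.card_eq_fintype_card]
  -- and `deg μ · n ≥ φ(D) = #(ℤ/D)ˣ`
  have hdeg : μ.natDegree = Module.finrank K K⟮ζ⟯ := (IntermediateField.adjoin.finrank hint).symm
  haveI : FiniteDimensional K K⟮ζ⟯ := IntermediateField.adjoin.finiteDimensional hint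
  have htower : Module.finrank ℚ K * Module.finrank K K⟮ζ⟯ =
      Module.finrank ℚ (IntermediateField.restrictScalars ℚ K⟮ζ⟯) :=
    Module.finrank_mul_finrank ℚ K K⟮ζ⟯
  haveI : FiniteDimensional ℚ (IntermediateField.restrictScalars ℚ K⟮ζ⟯) := by
    change FiniteDimensional ℚ K⟮ζ⟯
    exact Module.Finite.trans K K⟮ζ⟯
  have hQζ : Module.finrank ℚ ℚ⟮ζ⟯ = Nat.totient D := by
    rw [IntermediateField.adjoin.finrank (hζprim.isIntegral hD0).tower_top,
      ← cyclotomic_eq_minpoly_rat hζprim hD0, natDegree_cyclotomic]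
  have hle : ℚ⟮ζ⟯ ≤ IntermediateField.restrictScalars ℚ K⟮ζ⟯ := by
    rw [IntermediateField.adjoin_simple_le_iff]
    exact IntermediateField.mem_adjoin_simple_self K ζ
  have hφle : Nat.totient D ≤ Module.finrank ℚ K * μ.natDegree := by
    rw [hdeg, htower, ← hQζ]
    exact IntermediateField.finrank_le_of_le_right hle
  have hcardG : Nat.card (ZMod D)ˣ = Nat.totient D := by
    rw [Nat.card_eq_fintype_card, ZMod.card_units_eq_totient]
  -- so the index is at most `n`
  have hindex := R.index_mul_card
  rw [hcardG] at hindex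
  have hRpos : 0 < Nat.card R := Nat.card_pos
  by_contra hlt
  push Not at hlt
  have : Nat.totient D < R.index * Nat.card R := by
    calc Nat.totient D ≤ n * μ.natDegree := hφle
      _ ≤ n * Nat.card R := Nat.mul_le_mul_left _ hcardR
      _ < R.index * Nat.card R := Nat.mul_lt_mul_of_pos_right hlt hRpos
  omega

end GaloisK


/-! ### Admissible exponents `k ≡ 1 (mod p^e (p - 1))` -/

section Admissible

variable (K : IntermediateField ℚ ℂ) [FiniteDimensional ℚ K] {p : ℕ} [hp : Fact p.Prime]

/-- **`ζ^k` is a `K`-conjugate of `ζ = e^{2πi/D}`, `D = p^a (p-1) = φ(p^{a+1})`, for every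
`k ≡ 1 (mod p^e (p-1))` with `e ≥ v_p([K:ℚ]!) + 2`** (independently of `a`): such `k` is a
`[K:ℚ]!`-th power in `(ℤ/D)ˣ` (`exists_units_pow_eq_of_modEq_one`), and all `[K:ℚ]!`-th powers are
admissible (`aeval_pow_factorial_minpoly_eq_zero`). This is the statement "the image of
`Gal(K(μ_{p^∞})/K)` in `ℤ_pˣ` contains `1 + p^e ℤ_p`" used by Rohrlich (1984, §1) to pass from
`χ` to its conjugates `χ^k`. [folklore] -/
theorem aeval_pow_minpoly_eq_zero_of_modEq_one {a e k : ℕ}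
    (he : padicValNat p (Module.finrank ℚ K).factorial + 2 ≤ e)
    (hk : k ≡ 1 [MOD p ^ e * (p - 1)]) :
    aeval (Complex.exp (2 * Real.pi * Complex.I / (p ^ a * (p - 1) : ℕ)) ^ k)
      (minpoly K (Complex.exp (2 * Real.pi * Complex.I / (p ^ a * (p - 1) : ℕ)))) = 0 := by
  have hp2 := hp.out.two_le
  set D : ℕ := p ^ a * (p - 1) with hD
  haveI : NeZero D := ⟨(Nat.mul_pos (pow_pos hp.out.pos _) (by omega)).ne'⟩
  -- `k` is prime to `D`
  have he1 : 1 ≤ e := by omega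
  have hkp : k.Coprime p := by
    have h1 : k ≡ 1 [MOD p] := hk.of_dvd (dvd_mul_of_dvd_left (dvd_pow_self p (by omega)) _)
    rw [Nat.Coprime, h1.gcd_eq, Nat.gcd_one_left]
  have hkp1 : k.Coprime (p - 1) := by
    have h1 : k ≡ 1 [MOD p - 1] := hk.of_dvd (dvd_mul_left _ _)
    rw [Nat.Coprime, h1.gcd_eq, Nat.gcd_one_left]
  have hkD : k.Coprime (p ^ a * (p - 1)) := Nat.Coprime.mul_right (hkp.pow_right a) hkp1
  -- `k` is an `n!`-th power in `(ℤ/D)ˣ`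
  obtain ⟨g, hg⟩ := exists_units_pow_eq_of_modEq_one (p := p) (a := a)
    (Nat.factorial_ne_zero _) he hk hkD
  have hadm := aeval_pow_factorial_minpoly_eq_zero K (D := D) g
  rw [hg] at hadm
  have hmod : ((ZMod.unitOfCoprime k hkD : (ZMod D)ˣ) : ZMod D).val ≡ k [MOD D] := by
    rw [ZMod.coe_unitOfCoprime, ZMod.val_natCast]
    exact Nat.mod_modEq k D
  rwa [aeval_pow_minpoly_eq_of_modEq K hmod] at hadm

end Admissible

/-! ### Galois conjugation for a general newform: `S(χ) = 0 ⟹ S(χ^k) = 0` -/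

section NewformGalois

open ModularForms UpperHalfPlane

variable {p : ℕ} [hp : Fact p.Prime] {N : ℕ} [NeZero N] {f : CuspForm (CongruenceSubgroup.Gamma0 N) 2}

/-- The exponents `k ≡ 1 (mod p^e (p-1))`, `e ≥ 1`, are coprime to the order of any character
mod `p^m`, `m ≥ 1`. [folklore] -/
theorem coprime_orderOf_of_modEq_one {m : ℕ} (hm : m ≠ 0) (χ : DirichletCharacter ℂ (p ^ m))
    {e k : ℕ} (he : 1 ≤ e) (hk : k ≡ 1 [MOD p ^ e * (p - 1)]) : k.Coprime (orderOf χ) := by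
  have h1 : k ≡ 1 [MOD p * (p - 1)] :=
    hk.of_dvd (mul_dvd_mul_right (dvd_pow_self p (by omega)) _)
  have h : k.Coprime (p * (p - 1)) := by rw [Nat.Coprime, h1.gcd_eq, Nat.gcd_one_left]
  exact (h.pow_right m).of_dvd_right (orderOf_dvd_pow hm χ)

/-- **Galois conjugation preserves the vanishing of `∑_a χ(a){∞, a/p^m}_f` for every newform**
(Rohrlich 1984, §1, via Shimura 1977, Thm. 1): let `f ∈ S₂(Γ₀(N))` be a normalised newform with
coefficient field `K_f` (`[K_f : ℚ] = n`), `χ` a Dirichlet character mod `p^m` (`m ≥ 1`) with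
`∑_a χ(a){∞, a/p^m}_f = 0`, and `k ≡ 1 (mod p^e (p-1))` with `e ≥ v_p(n!) + 2`. Then
`∑_a χ^k(a){∞, a/p^m}_f = 0`. By parity the sum is `Ω⁺ ∑ χ(a) q_a` or `iΩ⁻ ∑ χ(a) q_a` with
`q_a ∈ K_f` (`IsNewform0.exists_plusSymbol_eq_mul`, `IsNewform0.exists_minusSymbol_eq_mul`), the
values of `χ` are `φ(p^m)`-th roots of unity, `ζ^k` is a `K_f`-conjugate of `ζ = e^{2πi/φ(p^m)}`
(`aeval_pow_minpoly_eq_zero_of_modEq_one`), so `sum_pow_apply_mul_eq_zero_of_aeval_minpoly` applies;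
`χ^k` has the parity of `χ`. The rational case (all `k` prime to `ord χ`) is
`twistedSymbolSum_pow_eq_zero_of_coprime`. [cite: RohrlichInventiones1984, §1] -/
theorem twistedSymbolSum_pow_eq_zero_of_modEq_one (hf : IsNewform0 f) {m : ℕ} (hm : m ≠ 0)
    {χ : DirichletCharacter ℂ (p ^ m)} (h0 : twistedSymbolSum f χ = 0) {e k : ℕ}
    (he : padicValNat p (Module.finrank ℚ (coeffField f)).factorial + 2 ≤ e)
    (hk : k ≡ 1 [MOD p ^ e * (p - 1)]) : twistedSymbolSum f (χ ^ k) = 0 := by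
  haveI : NeZero (p ^ m) := ⟨pow_ne_zero _ hp.out.ne_zero⟩
  set K : IntermediateField ℚ ℂ := coeffField f with hKdef
  haveI : FiniteDimensional ℚ K := IsNewform0.finiteDimensional_coeffField_holds hf
  obtain ⟨a, rfl⟩ : ∃ a, m = a + 1 := ⟨m - 1, by omega⟩
  have hp2 := hp.out.two_le
  -- `χ ^ D = 1`, `D = φ(p^{a+1}) = p^a (p-1)`
  set D : ℕ := p ^ a * (p - 1) with hD
  haveI : NeZero D := ⟨(Nat.mul_pos (pow_pos hp.out.pos _) (by omega)).ne'⟩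
  have hχD : χ ^ D = 1 := by
    ext u
    rw [MulChar.pow_apply_coe, MulChar.one_apply_coe, ← map_pow, ← Units.val_pow_eq_pow_val,
      show D = Nat.totient (p ^ (a + 1)) by rw [Nat.totient_prime_pow_succ hp.out],
      ZMod.pow_totient, Units.val_one, map_one]
  -- `ζ^k` is a `K`-conjugate of `ζ = e^{2πi/D}`
  have hadm := aeval_pow_minpoly_eq_zero_of_modEq_one K (p := p) (a := a) he hk
  -- parity of `χ^k`
  have hcop : k.Coprime (orderOf χ) := coprime_orderOf_of_modEq_one hm χ (by omega) hk
  have hpar := pow_apply_neg_one_of_coprime χ hcop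
  -- `K`-rationality of the symbols (Shimura)
  obtain ⟨Ωp, hΩp, hcp⟩ := hf.exists_plusSymbol_eq_mul
  obtain ⟨Ωm, hΩm, hcm⟩ := hf.exists_minusSymbol_eq_mul
  choose cp hcpK hcp using hcp
  choose cm hcmK hcm using hcm
  rcases apply_neg_one_eq_one_or χ with heven | hodd
  · -- even: plus symbols
    have hsum : ∀ ψ : DirichletCharacter ℂ (p ^ (a + 1)), ψ (-1) = 1 → twistedSymbolSum f ψ =
        (Ωp : ℂ) * ∑ b : ZMod (p ^ (a + 1)), ψ b * cp ((b.val : ℚ) / (p ^ (a + 1) : ℕ)) := by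
      intro ψ hψ
      rw [twistedSymbolSum_eq_sum_plusSymbol hψ, Finset.mul_sum]
      exact Finset.sum_congr rfl fun b _ ↦ by rw [hcp]; ring
    have hz : ∑ b : ZMod (p ^ (a + 1)), χ b * cp ((b.val : ℚ) / (p ^ (a + 1) : ℕ)) = 0 := by
      have h := hsum χ heven
      rw [h0] at h
      exact (mul_eq_zero.mp h.symm).resolve_left (Complex.ofReal_ne_zero.mpr hΩp)
    have hzk := sum_pow_apply_mul_eq_zero_of_aeval_minpoly K χ hχD
      (fun b ↦ cp ((b.val : ℚ) / (p ^ (a + 1) : ℕ))) (fun b ↦ hcpK _) hz hadm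
    rw [hsum (χ ^ k) (by rw [hpar, heven]), hzk, mul_zero]
  · -- odd: minus symbols
    have hsum : ∀ ψ : DirichletCharacter ℂ (p ^ (a + 1)), ψ (-1) = -1 → twistedSymbolSum f ψ =
        ((Ωm : ℂ) * Complex.I) *
          ∑ b : ZMod (p ^ (a + 1)), ψ b * cm ((b.val : ℚ) / (p ^ (a + 1) : ℕ)) := by
      intro ψ hψ
      rw [twistedSymbolSum_eq_sum_minusSymbol hψ, Finset.mul_sum]
      exact Finset.sum_congr rfl fun b _ ↦ by rw [hcm]; ring
    have hz : ∑ b : ZMod (p ^ (a + 1)), χ b * cm ((b.val : ℚ) / (p ^ (a + 1) : ℕ)) = 0 := by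
      have h := hsum χ hodd
      rw [h0] at h
      refine (mul_eq_zero.mp h.symm).resolve_left ?_
      exact mul_ne_zero (Complex.ofReal_ne_zero.mpr hΩm) Complex.I_ne_zero
    have hzk := sum_pow_apply_mul_eq_zero_of_aeval_minpoly K χ hχD
      (fun b ↦ cm ((b.val : ℚ) / (p ^ (a + 1) : ℕ))) (fun b ↦ hcmK _) hz hadm
    rw [hsum (χ ^ k) (by rw [hpar, hodd]), hzk, mul_zero]

end NewformGalois


/-! ### Families with support offset `e`: counting, Gauss sums, the two error terms -/

section FamilyOffset

open ModularForms UpperHalfPlane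

variable {p : ℕ} [hp : Fact p.Prime]

/-- **The support of `∑_{χ ∈ X} χ` has at most `4p^{e+1}` elements** whenever it is contained in
`{z : z^{2(p-1)} ≡ 1 (mod p^{m-e})}`, `e ≤ m` (`card_support_sum_le` is `e = 1`). [folklore] -/
theorem card_support_sum_le_offset {m e : ℕ} [NeZero (p ^ m)] (hem : e ≤ m)
    (X : Finset (DirichletCharacter ℂ (p ^ m)))
    (hsupp : ∀ z : ZMod (p ^ m), ∑ χ ∈ X, χ z ≠ 0 →
      (ZMod.castHom (pow_dvd_pow p (Nat.sub_le m e)) (ZMod (p ^ (m - e))) z) ^ (2 * (p - 1)) = 1) :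
    (Finset.univ.filter fun z : ZMod (p ^ m) ↦ ∑ χ ∈ X, χ z ≠ 0).card ≤ 4 * p * p ^ e := by
  classical
  set Q : ZMod (p ^ (m - e)) → Prop := fun r ↦ r ^ (2 * (p - 1)) = 1 with hQ
  calc _ ≤ (Finset.univ.filter fun z : ZMod (p ^ m) ↦
          Q (ZMod.castHom (pow_dvd_pow p (Nat.sub_le m e)) (ZMod (p ^ (m - e))) z)).card :=
        Finset.card_le_card fun z hz ↦ by
          rw [Finset.mem_filter] at hz ⊢
          exact ⟨hz.1, hsupp z hz.2⟩
    _ = ((Finset.range (p ^ m)).filter fun u : ℕ ↦ Q (u : ZMod (p ^ (m - e)))).card := by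
        rw [Finset.card_filter, Finset.card_filter, LFunctions.sum_zmod_eq_sum_range]
        refine Finset.sum_congr rfl fun n _ ↦ ?_
        rw [ZMod.castHom_apply, ZMod.cast_natCast (pow_dvd_pow p (Nat.sub_le m e))]
    _ = p ^ (m - (m - e)) * (Finset.univ.filter Q).card :=
        LFunctions.card_filter_range_pow_eq (Nat.sub_le m e) Q
    _ ≤ p ^ e * (4 * p) := by
        rw [show m - (m - e) = e by omega]
        exact Nat.mul_le_mul_left _ (card_filter_pow_eq_one_le (m - e))
    _ = 4 * p * p ^ e := by ring


/-- **The Gauss-sum average bound for a sparse family, offset `e`.** For a unit `y` mod `p^m` and a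
family `X` whose character sum is supported in `{z : z^{2(p-1)} ≡ 1 (mod p^{m-e})}`, `e ≤ m`:
`‖∑_{χ ∈ X} χ(y) τ(χ)²‖ ≤ 4p^{e+1} · #X · 4 p^{⌈m/2⌉}` (`norm_sum_mul_gaussSum_sq_le_of_support` is
`e = 1`). [folklore] -/
theorem norm_sum_mul_gaussSum_sq_le_of_support_offset {m e : ℕ} [NeZero (p ^ m)] (hem : e ≤ m)
    (X : Finset (DirichletCharacter ℂ (p ^ m)))
    (hsupp : ∀ z : ZMod (p ^ m), ∑ χ ∈ X, χ z ≠ 0 →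
      (ZMod.castHom (pow_dvd_pow p (Nat.sub_le m e)) (ZMod (p ^ (m - e))) z) ^ (2 * (p - 1)) = 1)
    {y : ZMod (p ^ m)} (hy : IsUnit y) :
    ‖∑ χ ∈ X, χ y * gaussSum χ (ZMod.stdAddChar (N := p ^ m)) ^ 2‖ ≤
      (4 * p * p ^ e : ℕ) * (X.card * (4 * (p : ℝ) ^ (m - m / 2))) := by
  classical
  rw [sum_mul_gaussSum_sq_eq_sum_kloosterman X hy]
  refine (norm_sum_le _ _).trans ?_
  calc ∑ h ∈ Finset.univ.filter (fun z : ZMod (p ^ m) ↦ ∑ χ ∈ X, χ z ≠ 0),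
        ‖(∑ χ ∈ X, χ h) * LFunctions.kloostermanSum (p ^ m) 1 (h * y⁻¹)‖
      ≤ ∑ h ∈ Finset.univ.filter (fun z : ZMod (p ^ m) ↦ ∑ χ ∈ X, χ z ≠ 0),
          X.card * (4 * (p : ℝ) ^ (m - m / 2)) := by
        refine Finset.sum_le_sum fun h _ ↦ ?_
        rw [norm_mul]
        exact mul_le_mul (norm_sum_apply_le_card X h) (LFunctions.norm_kloostermanSum_one_le m _)
          (norm_nonneg _) (Nat.cast_nonneg _)
    _ ≤ _ := by
        rw [Finset.sum_const, nsmul_eq_mul]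
        gcongr
        exact_mod_cast card_support_sum_le_offset hem X hsupp



variable {N : ℕ} [NeZero N] (f : CuspForm (CongruenceSubgroup.Gamma0 N) 2)

omit [NeZero N] in
/-- **The main-term error for a sparse family, offset `e`.** As
`norm_dampedTwist_sum_sub_le_of_support` (the case `e = 1`) with `q = p^{m-e}`: for `f` with
`a₁ = 1`, `|aₙ| ≤ C n^θ` (`0 < θ ≤ 1`), `Y > 0`, and a family `X` of characters mod `p^m` whose
character sum is supported in `{z : z^{2(p-1)} ≡ 1 (mod q)}`:
`‖D_f(A, Y) - #X e^{-2πY}‖ ≤ #X · C · 4p · (q^{(θ-1)/(2(p-1))} + q^{θ-1}(1 + Γ(θ)(2πYq)^{-θ}))`.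
[folklore] -/
theorem norm_dampedTwist_sum_sub_le_of_support_offset {m e : ℕ} [NeZero (p ^ m)]
    (X : Finset (DirichletCharacter ℂ (p ^ m)))
    (hsupp : ∀ z : ZMod (p ^ m), ∑ χ ∈ X, χ z ≠ 0 →
      (ZMod.castHom (pow_dvd_pow p (Nat.sub_le m e)) (ZMod (p ^ (m - e))) z) ^ (2 * (p - 1)) = 1)
    {C θ : ℝ} (hC : 0 ≤ C) (hθ : 0 < θ) (hθ1 : θ ≤ 1)
    (ha : ∀ n : ℕ, ‖cuspCoeff f n‖ ≤ C * (n : ℝ) ^ θ) (h1 : cuspCoeff f 1 = 1) {Y : ℝ} (hY : 0 < Y) :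
    ‖dampedTwist f (fun n ↦ ∑ χ ∈ X, χ n) Y - X.card * (Real.exp (-(2 * Real.pi) * Y) : ℝ)‖ ≤
      X.card * (C * ((4 * p : ℕ) *
        ((((p ^ (m - e) : ℕ) : ℝ) ^ (1 / (2 * (p - 1) : ℝ))) ^ (θ - 1) +
          ((p ^ (m - e) : ℕ) : ℝ) ^ (θ - 1) *
            (1 + Real.Gamma θ * (2 * Real.pi * Y * (p ^ (m - e) : ℕ)) ^ (-θ))))) := by
  classical
  set q : ℕ := p ^ (m - e) with hq
  have hq0 : 0 < q := pow_pos hp.out.pos _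
  haveI : NeZero q := ⟨hq0.ne'⟩
  set A : ℕ → ℂ := fun n ↦ ∑ χ ∈ X, χ n with hA
  set c : ℝ := 2 * Real.pi * Y with hc
  have hcpos : 0 < c := by positivity
  set term : ℕ → ℂ := fun n ↦ A n * cuspCoeff f n * (Real.exp (-(2 * Real.pi * n) * Y) / n : ℝ)
    with hterm
  have hAle : ∀ n : ℕ, ‖A n‖ ≤ X.card := fun n ↦ norm_sum_apply_le_card X _
  have hsum : Summable term := summable_dampedTwist f hAle hY
  -- the term `n = 1`
  have hA1 : A 1 = X.card := by simp [hA]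
  have ht1 : term 1 = X.card * (Real.exp (-(2 * Real.pi) * Y) : ℝ) := by
    simp only [hterm, hA1, h1, Nat.cast_one, mul_one, div_one]
  have hsplit : dampedTwist f (fun n ↦ ∑ χ ∈ X, χ n) Y -
      X.card * (Real.exp (-(2 * Real.pi) * Y) : ℝ) = ∑' n : ℕ, if n = 1 then 0 else term n := by
    rw [dampedTwist, show (fun n : ℕ ↦ (∑ χ ∈ X, χ (n : ZMod (p ^ m))) * cuspCoeff f n *
      (Real.exp (-(2 * Real.pi * n) * Y) / n : ℝ)) = term from rfl, hsum.tsum_eq_add_tsum_ite 1, ht1]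
    ring
  -- support on the integers
  have hsuppn : ∀ n : ℕ, A n ≠ 0 → ((n : ℕ) : ZMod q) ^ (2 * (p - 1)) = 1 := by
    intro n hn
    have h := hsupp (n : ZMod (p ^ m)) hn
    rwa [map_natCast] at h
  -- the majorant
  set S : ℕ → Prop := fun n ↦ ((n : ℕ) : ZMod q) ^ (2 * (p - 1)) = 1 with hS
  set g : ℕ → ℝ := fun n ↦ X.card * (C *
    (if S n ∧ 2 ≤ n then (n : ℝ) ^ (θ - 1) * Real.exp (-c * n) else 0)) with hg
  have hg0 : ∀ n, 0 ≤ g n := fun n ↦ by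
    simp only [hg]; split_ifs <;> positivity
  have hg_le : ∀ n, g n ≤ X.card * (C * ((n : ℝ) ^ (θ - 1) * Real.exp (-c * n))) := fun n ↦ by
    simp only [hg]
    split_ifs
    · exact le_rfl
    · rw [mul_zero, mul_zero]; positivity
  have hg_summable : Summable g :=
    Summable.of_nonneg_of_le hg0 hg_le (((summable_rpow_mul_exp hθ1 hcpos).mul_left C).mul_left _)
  -- pointwise comparison
  have hpt : ∀ n : ℕ, ‖(if n = 1 then (0 : ℂ) else term n)‖ ≤ g n := by
    intro n
    by_cases hn1 : n = 1
    · rw [if_pos hn1, norm_zero]; exact hg0 n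
    rw [if_neg hn1]
    rcases Nat.eq_zero_or_pos n with rfl | hnpos
    · simp only [hterm, Nat.cast_zero, div_zero, Complex.ofReal_zero, mul_zero, norm_zero]
      exact hg0 0
    have hn2 : 2 ≤ n := by omega
    by_cases hAn : A n = 0
    · simp only [hterm, hAn, zero_mul, norm_zero]; exact hg0 n
    have hSn : S n := hsuppn n hAn
    have hgn : g n = X.card * (C * ((n : ℝ) ^ (θ - 1) * Real.exp (-c * n))) := by
      simp only [hg, if_pos (And.intro hSn hn2)]
    rw [hgn, hterm]
    dsimp only
    rw [norm_mul, norm_mul, Complex.norm_real, Real.norm_of_nonneg (by positivity)]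
    have hnr : (0 : ℝ) < n := Nat.cast_pos.mpr hnpos
    calc ‖A n‖ * ‖cuspCoeff f n‖ * (Real.exp (-(2 * Real.pi * n) * Y) / n)
        ≤ X.card * (C * (n : ℝ) ^ θ) * (Real.exp (-(2 * Real.pi * n) * Y) / n) := by
          gcongr
          · exact hAle n
          · exact ha n
      _ = X.card * (C * ((n : ℝ) ^ (θ - 1) * Real.exp (-c * n))) := by
          rw [Real.rpow_sub_one hnr.ne', hc]
          field_simp
  -- partial sums of the majorant
  have hR := card_filter_pow_eq_one_le (p := p) (m - e)
  set n₀ : ℝ := ((q : ℕ) : ℝ) ^ (1 / (2 * (p - 1) : ℝ)) with hn₀def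
  have hn₀ : 0 < n₀ := by positivity
  have hE0 : 0 ≤ n₀ ^ (θ - 1) + ((q : ℕ) : ℝ) ^ (θ - 1) * (1 + Real.Gamma θ * (c * q) ^ (-θ)) := by
    have := Real.Gamma_pos_of_pos hθ; positivity
  have hpartial : ∀ M : ℕ, ∑ n ∈ Finset.range M, g n ≤ X.card * (C * ((4 * p : ℕ) *
      (n₀ ^ (θ - 1) + ((q : ℕ) : ℝ) ^ (θ - 1) * (1 + Real.Gamma θ * (c * q) ^ (-θ))))) := by
    intro M
    simp only [hg, ← Finset.mul_sum]
    refine mul_le_mul_of_nonneg_left (mul_le_mul_of_nonneg_left ?_ hC) (Nat.cast_nonneg _)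
    have h := sum_range_indicator_rpow_mul_exp_le hθ hθ1 hcpos hq0
      (Finset.univ.filter fun r : ZMod q ↦ r ^ (2 * (p - 1)) = 1) hn₀ S
      (fun n hn ↦ by simpa [hS] using hn) (fun n hn hn2 ↦ rpow_le_of_pow_cast_eq_one hq0 hn2 hn) M
    refine h.trans ?_
    have hR' : (((Finset.univ.filter fun r : ZMod q ↦ r ^ (2 * (p - 1)) = 1).card : ℕ) : ℝ) ≤
        ((4 * p : ℕ) : ℝ) := by exact_mod_cast hR
    exact mul_le_mul_of_nonneg_right hR' hE0
  -- conclusion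
  rw [hsplit]
  refine (tsum_of_norm_bounded hg_summable.hasSum hpt).trans ?_
  refine (Real.tsum_le_of_sum_range_le hg0 hpartial).trans (le_of_eq ?_)
  rw [hn₀def, hc]


omit [NeZero N] in
/-- **The dual-term error for a sparse family, offset `e`.** As
`norm_dampedTwist_dual_le_of_support` (the case `e = 1`): for `f ∈ S_2(Γ₀(N))` with
`|aₙ| ≤ C n^θ` (`0 < θ ≤ 1`), `p ∤ N`, `e ≤ m`, `Y' > 0`, and a family `X` of characters mod `p^m`
with character sum supported in `{z : z^{2(p-1)} ≡ 1 (mod p^{m-e})}`: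
`‖D_f(B, Y')‖ ≤ #X · C · (4p^{e+1} · 4p^{⌈m/2⌉}) · (1 + Γ(θ)(2πY')^{-θ})`. [folklore] -/
theorem norm_dampedTwist_dual_le_of_support_offset {m e : ℕ} [NeZero (p ^ m)] (hem : e ≤ m)
    (hpN : ¬ p ∣ N) (X : Finset (DirichletCharacter ℂ (p ^ m)))
    (hsupp : ∀ z : ZMod (p ^ m), ∑ χ ∈ X, χ z ≠ 0 →
      (ZMod.castHom (pow_dvd_pow p (Nat.sub_le m e)) (ZMod (p ^ (m - e))) z) ^ (2 * (p - 1)) = 1)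
    {C θ : ℝ} (hC : 0 ≤ C) (hθ : 0 < θ) (hθ1 : θ ≤ 1)
    (ha : ∀ n : ℕ, ‖cuspCoeff f n‖ ≤ C * (n : ℝ) ^ θ) {Y' : ℝ} (hY' : 0 < Y') :
    ‖dampedTwist f (fun n ↦ ∑ χ ∈ X,
        χ N * gaussSum χ (ZMod.stdAddChar (N := p ^ m)) ^ 2 * χ⁻¹ n) Y'‖ ≤
      X.card * (C * (((4 * p * p ^ e : ℕ) * (4 * (p : ℝ) ^ (m - m / 2))) *
        (1 + Real.Gamma θ * (2 * Real.pi * Y') ^ (-θ)))) := by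
  classical
  set β : ℝ := (4 * p * p ^ e : ℕ) * (4 * (p : ℝ) ^ (m - m / 2)) with hβ
  have hβ0 : 0 ≤ β := by positivity
  set Bw : ℕ → ℂ := fun n ↦ ∑ χ ∈ X, χ N * gaussSum χ (ZMod.stdAddChar (N := p ^ m)) ^ 2 * χ⁻¹ n
    with hBw
  set c : ℝ := 2 * Real.pi * Y' with hc
  have hcpos : 0 < c := by positivity
  have hNu : IsUnit ((N : ℕ) : ZMod (p ^ m)) := by
    rw [ZMod.isUnit_iff_coprime]
    exact ((Nat.Prime.coprime_iff_not_dvd hp.out).mpr hpN).symm.pow_right m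
  -- bound for the weight
  have hBle : ∀ n : ℕ, ‖Bw n‖ ≤ X.card * β := by
    intro n
    by_cases hn : IsUnit ((n : ℕ) : ZMod (p ^ m))
    · have : Bw n = ∑ χ ∈ X, χ ((N : ZMod (p ^ m)) * ((n : ℕ) : ZMod (p ^ m))⁻¹) *
          gaussSum χ (ZMod.stdAddChar (N := p ^ m)) ^ 2 := by
        refine Finset.sum_congr rfl fun χ _ ↦ ?_
        rw [← mul_inv_apply_eq χ _ hn]; ring
      rw [this]
      have hyu : IsUnit ((N : ZMod (p ^ m)) * ((n : ℕ) : ZMod (p ^ m))⁻¹) := by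
        refine hNu.mul ?_
        rw [← hn.unit_spec, ZMod.inv_coe_unit]; exact Units.isUnit _
      have h := norm_sum_mul_gaussSum_sq_le_of_support_offset hem X hsupp hyu
      rw [hβ]
      refine h.trans (le_of_eq ?_)
      push_cast; ring
    · have : Bw n = 0 := Finset.sum_eq_zero fun χ _ ↦ by rw [MulChar.map_nonunit χ⁻¹ hn, mul_zero]
      rw [this, norm_zero]; positivity
  -- the majorant (zero at `n = 0`, where the term vanishes)
  set h : ℕ → ℝ := fun n ↦
    if n = 0 then 0 else X.card * β * C * ((n : ℝ) ^ (θ - 1) * Real.exp (-c * n)) with hh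
  have hh0 : ∀ n, 0 ≤ h n := fun n ↦ by
    simp only [hh]; split_ifs <;> positivity
  have hh_le : ∀ n, h n ≤ X.card * β * C * ((n : ℝ) ^ (θ - 1) * Real.exp (-c * n)) := fun n ↦ by
    simp only [hh]; split_ifs <;> first | positivity | exact le_rfl
  have hh_summable : Summable h :=
    Summable.of_nonneg_of_le hh0 hh_le ((summable_rpow_mul_exp hθ1 hcpos).mul_left _)
  have hpt : ∀ n : ℕ, ‖Bw n * cuspCoeff f n * (Real.exp (-(2 * Real.pi * n) * Y') / n : ℝ)‖ ≤ h n := by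
    intro n
    rcases Nat.eq_zero_or_pos n with rfl | hnpos
    · simp only [Nat.cast_zero, div_zero, Complex.ofReal_zero, mul_zero, norm_zero]; exact hh0 0
    have hnr : (0 : ℝ) < n := Nat.cast_pos.mpr hnpos
    rw [norm_mul, norm_mul, Complex.norm_real, Real.norm_of_nonneg (by positivity), hh]
    dsimp only
    rw [if_neg hnpos.ne']
    calc ‖Bw n‖ * ‖cuspCoeff f n‖ * (Real.exp (-(2 * Real.pi * n) * Y') / n)
        ≤ (X.card * β) * (C * (n : ℝ) ^ θ) * (Real.exp (-(2 * Real.pi * n) * Y') / n) := by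
          gcongr
          · exact hBle n
          · exact ha n
      _ = X.card * β * C * ((n : ℝ) ^ (θ - 1) * Real.exp (-c * n)) := by
          rw [Real.rpow_sub_one hnr.ne', hc]
          field_simp
  -- `∑ h ≤ #X β C (1 + Γ c^{-θ})`
  have htsum : ∑' n, h n ≤ X.card * β * C * (1 + Real.Gamma θ * c ^ (-θ)) := by
    have h0 : h 0 = 0 := by simp only [hh, if_pos rfl]
    rw [hh_summable.tsum_eq_zero_add, h0, zero_add]
    have h' : ∀ n : ℕ, h (n + 1) = X.card * β * C *
        ((((n + 1 : ℕ) : ℝ)) ^ (θ - 1) * Real.exp (-c * ((n + 1 : ℕ) : ℝ))) := fun n ↦ by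
      simp only [hh, if_neg (Nat.succ_ne_zero n)]
    simp only [h']
    rw [tsum_mul_left]
    refine mul_le_mul_of_nonneg_left ?_ (by positivity)
    refine Real.tsum_le_of_sum_range_le (fun n ↦ by positivity) fun M ↦ ?_
    exact sum_range_rpow_mul_exp_le hθ hθ1 hcpos M
  rw [dampedTwist]
  refine (tsum_of_norm_bounded hh_summable.hasSum hpt).trans (htsum.trans (le_of_eq ?_))
  rw [hβ, hc]; ring


end FamilyOffset

/-! ### Asymptotics with support offset `e` -/

section FinalOffset

open ModularForms UpperHalfPlane

variable {p : ℕ} [hp : Fact p.Prime]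

/-- Exponent algebra for the main error term: with `X = p q`, `Y = X^{-a}`,
`q^{θ-1} (2π X^{-a} q)^{-θ} = (2π)^{-θ} p^{aθ} q^{aθ - 1}`. [folklore] -/
theorem main_exponent_eq_offset {p q θ a : ℝ} (hp : 0 < p) (hq : 0 < q) :
    q ^ (θ - 1) * (2 * Real.pi * (p * q) ^ (-a) * q) ^ (-θ) =
      (2 * Real.pi) ^ (-θ) * p ^ (a * θ) * q ^ (a * θ - 1) := by
  have h2π : (0 : ℝ) < 2 * Real.pi := Real.two_pi_pos
  have hpq : 0 < p * q := mul_pos hp hq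
  rw [Real.mul_rpow (by positivity) hq.le, Real.mul_rpow h2π.le (by positivity),
    ← Real.rpow_mul hpq.le, Real.mul_rpow hp.le hq.le,
    show -a * -θ = a * θ by ring]
  have : q ^ (θ - 1) * q ^ (a * θ) * q ^ (-θ) = q ^ (a * θ - 1) := by
    rw [← Real.rpow_add hq, ← Real.rpow_add hq]; ring_nf
  calc q ^ (θ - 1) * ((2 * Real.pi) ^ (-θ) * (p ^ (a * θ) * q ^ (a * θ)) * q ^ (-θ))
      = (2 * Real.pi) ^ (-θ) * p ^ (a * θ) * (q ^ (θ - 1) * q ^ (a * θ) * q ^ (-θ)) := by ring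
    _ = _ := by rw [this]

/-- Exponent algebra for the dual error term: with `Y = X^{-a}`, `Y' = 1/(N X² Y)`,
`(2π Y')^{-θ} = (2π/N)^{-θ} X^{(2-a)θ}`. [folklore] -/
theorem dual_exponent_eq_offset {N X θ a : ℝ} (hN : 0 < N) (hX : 0 < X) :
    (2 * Real.pi * (1 / (N * X ^ 2 * X ^ (-a)))) ^ (-θ) =
      (2 * Real.pi / N) ^ (-θ) * X ^ ((2 - a) * θ) := by
  have h2π : (0 : ℝ) < 2 * Real.pi := Real.two_pi_pos
  have hX2 : X ^ 2 * X ^ (-a) = X ^ (2 - a : ℝ) := by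
    rw [show X ^ 2 = X ^ (2 : ℝ) by norm_cast, ← Real.rpow_add hX, sub_eq_add_neg]
  rw [mul_assoc N, hX2, show 2 * Real.pi * (1 / (N * X ^ (2 - a : ℝ))) =
    (2 * Real.pi / N) * (X ^ (2 - a : ℝ))⁻¹ by field_simp, Real.mul_rpow (by positivity)
    (by positivity), Real.inv_rpow (by positivity), ← Real.rpow_mul hX.le, ← Real.rpow_neg
    (by positivity)]
  congr 2
  ring

/-- `p^{⌈m/2⌉} ≤ p · (p^m)^{1/2}`. [folklore] -/
theorem pow_ceil_half_le_offset {p : ℝ} (hp : 1 ≤ p) (m : ℕ) :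
    p ^ (m - m / 2) ≤ p * (p ^ m) ^ (1 / 2 : ℝ) := by
  have hp0 : 0 ≤ p := by linarith
  have h2 : ((m - m / 2 : ℕ) : ℝ) ≤ 1 + m * (1 / 2 : ℝ) := by
    have : 2 * (m - m / 2) ≤ m + 2 := by omega
    have h' : ((2 * (m - m / 2) : ℕ) : ℝ) ≤ ((m + 2 : ℕ) : ℝ) := by exact_mod_cast this
    push_cast at h'
    linarith
  calc p ^ (m - m / 2) = p ^ ((m - m / 2 : ℕ) : ℝ) := (Real.rpow_natCast p _).symm
    _ ≤ p ^ (1 + m * (1 / 2 : ℝ)) := Real.rpow_le_rpow_of_exponent_le hp h2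
    _ = p * (p ^ m) ^ (1 / 2 : ℝ) := by
        rw [Real.rpow_add' hp0 (by positivity), Real.rpow_one, Real.rpow_natCast_mul hp0]



variable {N : ℕ} [NeZero N] (f : CuspForm (CongruenceSubgroup.Gamma0 N) 2)

/-- **No admissible family of large conductor is killed by the symbol sums — support offset `e`.**
As `exists_forall_family_exists_twistedSymbolSum_ne_zero` (the case `e = 1`), for families of
primitive characters mod `p^m` of constant parity whose character sum is supported in
`{z : z^{2(p-1)} ≡ 1 (mod p^{m-e})}` for a fixed `e ≥ 1`: with `q = p^{m-e}`, `X = p^m = p^e q`,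
`Y = X^{-a}`, `3/2 < a < 1/θ`, the first moment over the family is `ε #X (e^{-2πY} + O(δ_m))`,
`δ_m → 0` uniformly in the family (`sum_family_twistedSymbolSum_eq`,
`norm_dampedTwist_sum_sub_le_of_support_offset`, `norm_dampedTwist_dual_le_of_support_offset`);
only the constants change (`4p ↦ 4p`, `4p² ↦ 4p^{e+1}`, `p^{aθ} ↦ p^{eaθ}`). This is the
analytic input of Rohrlich's theorem for a newform with arbitrary coefficient field, whose Galois
families have support offset `e = e(f, p)` (Rohrlich 1984, §§2–4). [folklore] -/
theorem exists_forall_family_exists_twistedSymbolSum_ne_zero_offset {e : ℕ} (he : 1 ≤ e)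
    {g : CuspForm (CongruenceSubgroup.Gamma0 N) 2}
    (hW : IsFrickePair N f g) (hpN : ¬ p ∣ N) {C θ C' θ' : ℝ} (hC : 0 ≤ C) (hθ : 0 < θ)
    (hθ1 : θ < 2 / 3) (hC' : 0 ≤ C') (hθ' : 0 < θ') (hθ'1 : θ' ≤ 1)
    (ha : ∀ n : ℕ, ‖cuspCoeff f n‖ ≤ C * (n : ℝ) ^ θ)
    (hb : ∀ n : ℕ, ‖cuspCoeff g n‖ ≤ C' * (n : ℝ) ^ θ') (h1 : cuspCoeff f 1 = 1) :
    ∃ m₀ : ℕ, ∀ m : ℕ, m₀ ≤ m → ∀ (X : Finset (DirichletCharacter ℂ (p ^ m))) (ε : ℂ),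
      X.Nonempty → (∀ χ ∈ X, χ.IsPrimitive ∧ χ (-1) = ε) →
      (∀ z : ZMod (p ^ m), ∑ χ ∈ X, χ z ≠ 0 →
        (ZMod.castHom (pow_dvd_pow p (Nat.sub_le m e)) (ZMod (p ^ (m - e))) z) ^ (2 * (p - 1)) = 1) →
      ∃ χ ∈ X, twistedSymbolSum f χ⁻¹ ≠ 0 := by
  have hpr : (1 : ℝ) < p := by exact_mod_cast hp.out.one_lt
  have hp0 : (0 : ℝ) < p := by linarith
  have hNr : (0 : ℝ) < N := Nat.cast_pos.mpr (NeZero.pos N)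
  have h2π : (0 : ℝ) < 2 * Real.pi := Real.two_pi_pos
  -- the exponent `a`, `3/2 < a < 1/θ`
  set a : ℝ := 3 / 4 + 1 / (2 * θ) with hadef
  have haθ' : a * θ = 3 / 4 * θ + 1 / 2 := by
    rw [hadef]; field_simp
  have haθ : a * θ - 1 < 0 := by rw [haθ']; linarith
  have ha32 : 3 / 2 < a := by
    have : 3 / 4 < 1 / (2 * θ) := by
      rw [lt_div_iff₀ (by positivity)]; linarith
    rw [hadef]; linarith
  have ha0 : 0 < a := by linarith
  have hdual : (2 - a) * θ' - 1 / 2 < 0 := by nlinarith [mul_pos (sub_pos.mpr ha32) hθ', hθ'1]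
  -- the parameters as functions of `m`
  set X : ℕ → ℝ := fun m ↦ (p : ℝ) ^ m with hXdef
  set q : ℕ → ℝ := fun m ↦ (p : ℝ) ^ (m - e) with hqdef
  set Y : ℕ → ℝ := fun m ↦ X m ^ (-a) with hYdef
  have hXpos : ∀ m, 0 < X m := fun m ↦ pow_pos hp0 m
  have hqpos : ∀ m, 0 < q m := fun m ↦ pow_pos hp0 _
  have hYpos : ∀ m, 0 < Y m := fun m ↦ Real.rpow_pos_of_pos (hXpos m) _
  have hpe0 : (0 : ℝ) < (p : ℝ) ^ e := pow_pos hp0 e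
  have hXq : ∀ m, e ≤ m → X m = (p : ℝ) ^ e * q m := fun m hm ↦ by
    simp only [hXdef, hqdef]
    rw [← pow_add, Nat.add_sub_cancel' hm]
  -- the error sequences
  set e₁ : ℝ := (θ - 1) / (2 * (p - 1) : ℝ) with he₁
  set K₃ : ℝ := Real.Gamma θ * ((2 * Real.pi) ^ (-θ) * ((p : ℝ) ^ e) ^ (a * θ)) with hK₃
  set err₁ : ℕ → ℝ := fun m ↦ C * ((4 * p : ℕ) *
    (q m ^ e₁ + (q m ^ (θ - 1) + K₃ * q m ^ (a * θ - 1)))) with herr₁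
  set K₄ : ℝ := C' * ((4 * p * p ^ e : ℕ) * (4 * (p : ℝ))) with hK₄
  set K₅ : ℝ := Real.Gamma θ' * (2 * Real.pi / N) ^ (-θ') with hK₅
  set err₂ : ℕ → ℝ := fun m ↦ K₄ * (X m ^ (-(1 / 2 : ℝ)) + K₅ * X m ^ ((2 - a) * θ' - 1 / 2))
    with herr₂
  -- limits
  have hXlim : Tendsto X atTop atTop := tendsto_pow_atTop_atTop_of_one_lt hpr
  have hqlim : Tendsto q atTop atTop :=
    (tendsto_pow_atTop_atTop_of_one_lt hpr).comp (tendsto_sub_atTop_nat e)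
  have hrpow : ∀ {Z : ℕ → ℝ} (_ : Tendsto Z atTop atTop) {e : ℝ} (_ : e < 0),
      Tendsto (fun m ↦ Z m ^ e) atTop (𝓝 0) := by
    intro Z hZ e he
    have h := (tendsto_rpow_neg_atTop (neg_pos.mpr he)).comp hZ
    simp only [neg_neg] at h
    exact h
  have hp1r : (1 : ℝ) ≤ (p : ℝ) - 1 := by
    have : (2 : ℝ) ≤ p := by exact_mod_cast hp.out.two_le
    linarith
  have he₁neg : e₁ < 0 := div_neg_of_neg_of_pos (by linarith) (by positivity)
  have herr₁lim : Tendsto err₁ atTop (𝓝 0) := by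
    have h := ((hrpow hqlim he₁neg).add ((hrpow hqlim (by linarith : θ - 1 < 0)).add
      ((hrpow hqlim haθ).const_mul K₃))).const_mul ((4 * p : ℕ) : ℝ)
      |>.const_mul C
    simpa [herr₁] using h
  have herr₂lim : Tendsto err₂ atTop (𝓝 0) := by
    have h := ((hrpow hXlim (by norm_num : -(1 / 2 : ℝ) < 0)).add
      ((hrpow hXlim hdual).const_mul K₅)).const_mul K₄
    simpa [herr₂] using h
  have hexplim : Tendsto (fun m ↦ Real.exp (-(2 * Real.pi) * Y m)) atTop (𝓝 1) := by
    have hY0 : Tendsto Y atTop (𝓝 0) := hrpow hXlim (by linarith : -a < 0)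
    have h0 : Tendsto (fun m ↦ -(2 * Real.pi) * Y m) atTop (𝓝 0) := by
      simpa using hY0.const_mul (-(2 * Real.pi))
    have := (Real.continuous_exp.tendsto 0).comp h0
    rw [Real.exp_zero] at this
    refine this.congr fun m ↦ ?_
    simp only [Function.comp_apply]
  -- choose `m₀`
  have hev : ∀ᶠ m in atTop, err₁ m + err₂ m < 1 / 2 ∧ 1 / 2 < Real.exp (-(2 * Real.pi) * Y m) ∧ e ≤ m := by
    refine ((herr₁lim.add herr₂lim).eventually (gt_mem_nhds ?_)).and
      ((hexplim.eventually (lt_mem_nhds ?_)).and (eventually_ge_atTop e))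
    · norm_num
    · norm_num
  obtain ⟨m₀, hm₀⟩ := eventually_atTop.mp hev
  refine ⟨m₀, fun m hm Xf ε hne hXf hsupp ↦ ?_⟩
  obtain ⟨hlt, hexp, hem⟩ := hm₀ m hm
  -- suppose all the twisted symbol sums vanish
  by_contra hall
  push Not at hall
  have hm0 : m ≠ 0 := by omega
  have hcard : 0 < (Xf.card : ℝ) := by exact_mod_cast Finset.card_pos.mpr hne
  -- `ε ≠ 0`
  have hε : ε ≠ 0 := by
    obtain ⟨χ, hχ⟩ := hne
    rw [← (hXf χ hχ).2]
    rcases apply_neg_one_eq_one_or χ with h | h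
    · rw [h]; exact one_ne_zero
    · rw [h]; exact neg_ne_zero.mpr one_ne_zero
  -- the moment vanishes
  have hmom : ∑ χ ∈ Xf, gaussSum χ (ZMod.stdAddChar (N := p ^ m)) / (p ^ m : ℂ) *
      twistedSymbolSum f χ⁻¹ = 0 :=
    Finset.sum_eq_zero fun χ hχ ↦ by rw [hall χ hχ, mul_zero]
  rw [sum_family_twistedSymbolSum_eq f hW hpN Xf hXf (hYpos m)] at hmom
  replace hmom := (mul_eq_zero.mp hmom).resolve_left hε
  -- the two error bounds at `Y = Y m`
  have hE₁ := norm_dampedTwist_sum_sub_le_of_support_offset f (p := p) Xf hsupp hC hθ (by linarith)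
    ha h1 (hYpos m)
  have hY'pos : 0 < 1 / ((N : ℝ) * (p ^ m : ℕ) ^ 2 * Y m) := by
    have : (0 : ℝ) < (p ^ m : ℕ) := Nat.cast_pos.mpr (pow_pos hp.out.pos _)
    have := hYpos m
    positivity
  have hE₂ := norm_dampedTwist_dual_le_of_support_offset g (p := p) hem hpN Xf hsupp hC' hθ' hθ'1 hb hY'pos
  -- simplify the error bounds to `#X · err₁ m` and `#X · err₂ m`
  have hqM : ((p ^ (m - e) : ℕ) : ℝ) = q m := by simp [hqdef]
  have hXM : ((p ^ m : ℕ) : ℝ) = X m := by simp [hXdef]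
  have hA : (q m ^ (1 / (2 * (p - 1) : ℝ))) ^ (θ - 1) = q m ^ e₁ := by
    rw [← Real.rpow_mul (hqpos m).le, he₁]
    congr 1
    have : (2 * (p - 1) : ℝ) ≠ 0 := by positivity
    field_simp
  have hB : q m ^ (θ - 1) * (1 + Real.Gamma θ * (2 * Real.pi * Y m * q m) ^ (-θ)) =
      q m ^ (θ - 1) + K₃ * q m ^ (a * θ - 1) := by
    rw [hYdef]
    dsimp only
    rw [hXq m hem, hK₃]
    have h := main_exponent_eq_offset (θ := θ) (a := a) hpe0 (hqpos m)
    linear_combination Real.Gamma θ * h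
  have hE₁' : ‖dampedTwist f (fun n ↦ ∑ χ ∈ Xf, χ n) (Y m) -
      Xf.card * (Real.exp (-(2 * Real.pi) * Y m) : ℝ)‖ ≤ Xf.card * err₁ m := by
    have h := hE₁
    rw [hqM, hA, hB] at h
    simpa only [herr₁] using h
  have hE₂' : ‖(1 / (p ^ m : ℂ)) * dampedTwist g (fun n ↦ ∑ χ ∈ Xf,
      χ N * gaussSum χ (ZMod.stdAddChar (N := p ^ m)) ^ 2 * χ⁻¹ n) (1 / ((N : ℝ) * (p ^ m : ℕ) ^ 2 * Y m))‖ ≤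
      Xf.card * err₂ m := by
    rw [norm_mul, norm_div, norm_one, show ‖(p ^ m : ℂ)‖ = X m by
      rw [show (p ^ m : ℂ) = ((p ^ m : ℕ) : ℂ) by push_cast; rfl, Complex.norm_natCast, hXM]]
    refine (mul_le_mul_of_nonneg_left hE₂ (by positivity)).trans ?_
    rw [hXM]
    have hZ : (2 * Real.pi * (1 / ((N : ℝ) * X m ^ 2 * Y m))) ^ (-θ') =
        (2 * Real.pi / N) ^ (-θ') * X m ^ ((2 - a) * θ') := by
      rw [hYdef]; exact dual_exponent_eq_offset hNr (hXpos m)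
    have hpk : (p : ℝ) ^ (m - m / 2) ≤ p * X m ^ (1 / 2 : ℝ) := pow_ceil_half_le_offset hpr.le m
    have hG : 0 ≤ Real.Gamma θ' := (Real.Gamma_pos_of_pos hθ').le
    have hx1 : X m ^ (1 / 2 : ℝ) / X m = X m ^ (-(1 / 2 : ℝ)) := by
      rw [div_eq_iff (hXpos m).ne', ← Real.rpow_add_one (hXpos m).ne']
      norm_num
    have hx2 : X m ^ (1 / 2 : ℝ) * X m ^ ((2 - a) * θ') / X m = X m ^ ((2 - a) * θ' - 1 / 2) := by
      rw [div_eq_iff (hXpos m).ne', ← Real.rpow_add (hXpos m), ← Real.rpow_add_one (hXpos m).ne']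
      congr 1; ring
    rw [hZ]
    calc 1 / X m * ((Xf.card) * (C' * (((4 * p * p ^ e : ℕ) * (4 * (p : ℝ) ^ (m - m / 2))) *
          (1 + Real.Gamma θ' * ((2 * Real.pi / N) ^ (-θ') * X m ^ ((2 - a) * θ'))))))
        ≤ 1 / X m * ((Xf.card) * (C' * (((4 * p * p ^ e : ℕ) * (4 * ((p : ℝ) * X m ^ (1 / 2 : ℝ)))) *
          (1 + Real.Gamma θ' * ((2 * Real.pi / N) ^ (-θ') * X m ^ ((2 - a) * θ')))))) := by
          gcongr
      _ = (Xf.card) * (C' * ((4 * p * p ^ e : ℕ) * (4 * (p : ℝ)))) *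
          (X m ^ (1 / 2 : ℝ) / X m + Real.Gamma θ' * (2 * Real.pi / N) ^ (-θ') *
            (X m ^ (1 / 2 : ℝ) * X m ^ ((2 - a) * θ') / X m)) := by
          ring
      _ = (Xf.card) * err₂ m := by
          rw [hx1, hx2]
          simp only [herr₂, hK₄, hK₅]
          ring
  -- the contradiction
  have hkey : (Xf.card : ℝ) * Real.exp (-(2 * Real.pi) * Y m) ≤
      Xf.card * err₁ m + Xf.card * err₂ m := by
    have hnorm : ‖((Xf.card) * (Real.exp (-(2 * Real.pi) * Y m) : ℝ) : ℂ)‖ =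
        (Xf.card : ℝ) * Real.exp (-(2 * Real.pi) * Y m) := by
      rw [show ((Xf.card) * (Real.exp (-(2 * Real.pi) * Y m) : ℝ) : ℂ) =
        (((Xf.card) * Real.exp (-(2 * Real.pi) * Y m) : ℝ) : ℂ) by push_cast; ring,
        Complex.norm_real, Real.norm_of_nonneg (by positivity)]
    rw [← hnorm]
    set D₁ := dampedTwist f (fun n ↦ ∑ χ ∈ Xf, χ n) (Y m)
    set D₂ := (1 / (p ^ m : ℂ)) * dampedTwist g (fun n ↦ ∑ χ ∈ Xf,
      χ N * gaussSum χ (ZMod.stdAddChar (N := p ^ m)) ^ 2 * χ⁻¹ n) (1 / ((N : ℝ) * (p ^ m : ℕ) ^ 2 * Y m))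
    have hD : D₁ = D₂ := sub_eq_zero.mp hmom
    calc ‖((Xf.card) * (Real.exp (-(2 * Real.pi) * Y m) : ℝ) : ℂ)‖
        = ‖((((Xf.card) * (Real.exp (-(2 * Real.pi) * Y m) : ℝ) : ℂ) - D₁) + D₂)‖ := by
          rw [hD, sub_add_cancel]
      _ ≤ ‖((Xf.card) * (Real.exp (-(2 * Real.pi) * Y m) : ℝ) : ℂ) - D₁‖ + ‖D₂‖ :=
          norm_add_le _ _
      _ ≤ _ := by
          refine add_le_add ?_ hE₂'
          rw [norm_sub_rev]; exact hE₁'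
  have : Real.exp (-(2 * Real.pi) * Y m) ≤ err₁ m + err₂ m := by
    have h := hkey
    rw [← mul_add] at h
    exact le_of_mul_le_mul_left h hcard
  linarith


end FinalOffset


/-! ### The support lemma with offset `e` -/

section SupportOffset

variable {p : ℕ} [hp : Fact p.Prime]

/-- **Support lemma, offset `e`.** For a primitive character `χ` mod `p^m` (`m ≥ 1`), `e ≥ 1`, and a
unit `u` with `χ(u)^{p^e (p-1)} = 1`: `u^{2(p-1)} ≡ 1 (mod p^{m-e})`. From the case `e = 1`
(`castHom_pow_eq_one_of_apply_pow_eq_one_prime`) applied to `u^{p^{e-1}}`, which gives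
`(u^{2(p-1)})^{p^{e-1}} ≡ 1 (mod p^{m-1})`, and the lifting-the-exponent lemma
(`modEq_one_of_pow_prime_pow_modEq_one`). [folklore] -/
theorem castHom_pow_eq_one_of_apply_pow_eq_one_offset {m e : ℕ} (hm : m ≠ 0) (he : 1 ≤ e)
    {χ : DirichletCharacter ℂ (p ^ m)} (hχ : χ.IsPrimitive) {u : (ZMod (p ^ m))ˣ}
    (hu : χ u ^ (p ^ e * (p - 1)) = 1) :
    (ZMod.castHom (pow_dvd_pow p (Nat.sub_le m e)) (ZMod (p ^ (m - e))) (u : ZMod (p ^ m))) ^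
      (2 * (p - 1)) = 1 := by
  haveI : NeZero (p ^ m) := ⟨pow_ne_zero _ hp.out.ne_zero⟩
  have hp2 := hp.out.two_le
  rcases Nat.lt_or_ge m e with hme | hme
  · -- `m < e`: the target ring is `ℤ/1`
    have h0 : m - e = 0 := by omega
    have : Subsingleton (ZMod (p ^ (m - e))) := by rw [h0, pow_zero]; infer_instance
    exact Subsingleton.elim _ _
  -- `w = u^{p^{e-1}}` satisfies the hypothesis of the case `e = 1`
  set w : (ZMod (p ^ m))ˣ := u ^ p ^ (e - 1) with hw
  have hwu : χ w ^ (p * (p - 1)) = 1 := by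
    rw [hw, Units.val_pow_eq_pow_val, map_pow, ← pow_mul, ← hu]
    congr 1
    rw [← mul_assoc, ← pow_succ, Nat.sub_add_cancel he]
  have h1 := castHom_pow_eq_one_of_apply_pow_eq_one_prime hm hχ hwu
  -- in terms of the representative `k` of `u`
  set k : ℕ := (u : ZMod (p ^ m)).val with hk
  have hwk : ((w : (ZMod (p ^ m))ˣ) : ZMod (p ^ m)) = ((k ^ p ^ (e - 1) : ℕ) : ZMod (p ^ m)) := by
    rw [hw, units_pow_eq_natCast_pow]
  rw [hwk, ZMod.castHom_apply, ZMod.cast_natCast (pow_dvd_pow p (Nat.sub_le m 1)), ← Nat.cast_pow,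
    show (1 : ZMod (p ^ (m - 1))) = ((1 : ℕ) : ZMod (p ^ (m - 1))) by rw [Nat.cast_one],
    ZMod.natCast_eq_natCast_iff, ← pow_mul, mul_comm, pow_mul] at h1
  -- `h1 : (k^{2(p-1)})^{p^{e-1}} ≡ 1 (mod p^{m-1})`; lift the exponent
  have hkp : k.Coprime p := (ZMod.val_coe_unit_coprime u).coprime_dvd_right (dvd_pow_self p hm)
  have hy1 : k ^ (2 * (p - 1)) ≡ 1 [MOD p] := by
    have h := Nat.ModEq.pow_totient hkp
    rw [Nat.totient_prime hp.out] at h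
    simpa [pow_mul, mul_comm] using (h.pow 2)
  have hy4 : p = 2 → k ^ (2 * (p - 1)) ≡ 1 [MOD 4] := by
    rintro rfl
    have hodd : Odd k := Nat.coprime_two_right.mp hkp
    have h8 := Nat.eight_dvd_sq_sub_one_of_odd hodd
    have h4 : 4 ∣ k ^ 2 - 1 := dvd_trans (by norm_num) h8
    have hk1 : 1 ≤ k ^ 2 := Nat.one_le_pow _ _ hodd.pos
    have := ((Nat.modEq_iff_dvd' hk1).mpr h4).symm
    simpa using this
  have h1' : (k ^ (2 * (p - 1))) ^ p ^ (e - 1) ≡ 1 [MOD p ^ ((m - e) + (e - 1))] := by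
    rwa [show m - e + (e - 1) = m - 1 by omega]
  have hy := modEq_one_of_pow_prime_pow_modEq_one hy1 hy4 h1'
  rw [ZMod.castHom_apply, ZMod.cast_eq_val, ← hk, ← Nat.cast_pow,
    show (1 : ZMod (p ^ (m - e))) = ((1 : ℕ) : ZMod (p ^ (m - e))) by rw [Nat.cast_one],
    ZMod.natCast_eq_natCast_iff]
  exact hy

end SupportOffset


/-! ### Rohrlich's theorem for an arbitrary newform and `P = {p}`, given a coefficient bound -/

section MainGeneral

open ModularForms UpperHalfPlane

variable {p : ℕ} [hp : Fact p.Prime] {N : ℕ} [NeZero N]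
  {f : CuspForm (CongruenceSubgroup.Gamma0 N) 2}

/-- **Rohrlich's non-vanishing theorem for an arbitrary newform, twists of `p`-power conductor,
conditional only on a coefficient bound** (Rohrlich 1984, Theorem, p. 409, case `ψ = 1`, `P = {p}`).
Let `f ∈ S₂(Γ₀(N))` be a normalised newform — with *any* coefficient field `K_f` — satisfying
`|aₙ(f)| ≤ C n^θ` for some `θ < 2/3` (for a general newform this is the Ramanujan–Petersson bound
`|aₙ| ≤ d(n) √n` of Eichler–Shimura–Igusa / Deligne, which the tree does not have; for rational
newforms of elliptic curves it is Hasse's bound, `Rohrlich1984_primePow_of_isNewformOf`), and let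
`p ∤ N` be prime. Then only finitely many primitive Dirichlet characters of `p`-power conductor have
`L(f, χ, 1) = 0`. Proof: as `Rohrlich1984_primePow_of_coeffField_eq_bot`, with the Galois step over
`K_f` (`twistedSymbolSum_pow_eq_zero_of_modEq_one`: Shimura's theorem on the periods over `K_f`,
`NewformPeriodsCoeffField`, and the conjugates `χ^k`, `k ≡ 1 (mod p^e (p-1))`, `e = v_p([K_f:ℚ]!) + 2`)
and the family `ψ⟨ψ^{p^e(p-1)}⟩` of the exceptional character `ψ`, whose character sum is supported in
`{z : z^{2(p-1)} ≡ 1 (mod p^{m-e})}` (`castHom_pow_eq_one_of_apply_pow_eq_one_offset`); the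
first-moment asymptotics with this offset is `exists_forall_family_exists_twistedSymbolSum_ne_zero_offset`.
[cite: RohrlichInventiones1984, Theorem (p. 409)] -/
theorem Rohrlich1984_primePow_of_coeffBound (hf : IsNewform0 f)
    {C θ : ℝ} (hC : 0 ≤ C) (hθ : 0 < θ) (hθ1 : θ < 2 / 3)
    (ha : ∀ n : ℕ, ‖cuspCoeff f n‖ ≤ C * (n : ℝ) ^ θ) (hpN : ¬ p ∣ N) :
    Set.Finite {χ : Σ m : ℕ, DirichletCharacter ℂ m |
      χ.1 ≠ 0 ∧ χ.1.primeFactors ⊆ {p} ∧ χ.2.IsPrimitive ∧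
        ∃ L : ℂ → ℂ, Differentiable ℂ L ∧
          (∀ s : ℂ, 2 < s.re → L s = twistedLSeries f χ.2 s) ∧ L 1 = 0} := by
  classical
  -- the support offset `e = e(f, p)` of the Galois families and the step `r = p^e (p-1)`
  set e : ℕ := padicValNat p (Module.finrank ℚ (coeffField f)).factorial + 2 with hedef
  have he1 : 1 ≤ e := by omega
  set r : ℕ := p ^ e * (p - 1) with hrdef
  have hmodr : ∀ j : ℕ, 1 + r * j ≡ 1 [MOD p ^ e * (p - 1)] := fun j ↦ by
    change (1 + r * j) % r = 1 % r
    exact Nat.add_mul_mod_self_left 1 r j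
  -- the inputs of the family theorem for the Fricke pair `(f, w_N f)`
  have hW : IsFrickePair N f (frickeInvolution N 2 f) := isFrickePair_frickeInvolution N f
  have h1 : cuspCoeff f 1 = 1 := (isNormalized_iff_cuspCoeff_one f).mp hf.2.2
  obtain ⟨C', hC', hb⟩ := exists_norm_cuspCoeff_le_mul (frickeInvolution N 2 f)
  have hb' : ∀ n : ℕ, ‖cuspCoeff (frickeInvolution N 2 f) n‖ ≤ C' * (n : ℝ) ^ (1 : ℝ) :=
    fun n ↦ by simpa only [Real.rpow_one] using hb n
  obtain ⟨m₀, hm₀⟩ := exists_forall_family_exists_twistedSymbolSum_ne_zero_offset f he1 hW hpN hC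
    hθ hθ1 hC'.le one_pos le_rfl ha hb' h1
  -- the finite set of characters of conductor `p^m`, `m < m₁ = max m₀ 1`
  set m₁ : ℕ := max m₀ 1 with hm₁
  have hfin : Set.Finite (⋃ m ∈ (↑(Finset.range m₁) : Set ℕ),
      Set.range (Sigma.mk (β := fun n : ℕ ↦ DirichletCharacter ℂ n) (p ^ m))) := by
    refine (Finset.range m₁).finite_toSet.biUnion fun m _ ↦ ?_
    haveI : NeZero (p ^ m) := ⟨pow_ne_zero _ hp.out.ne_zero⟩
    exact Set.finite_range _
  refine hfin.subset ?_
  rintro ⟨n, ψ⟩ ⟨hn0, hP, hprim, L, hLd, hL, hL1⟩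
  dsimp only at hn0 hP hprim hL hL1
  -- `n = p^m`
  obtain ⟨m, rfl⟩ : ∃ m, n = p ^ m := by
    refine ⟨_, Nat.eq_prime_pow_of_unique_prime_dvd hn0 fun {d} hd hdn ↦ ?_⟩
    have : d ∈ ({p} : Finset ℕ) := hP (Nat.mem_primeFactors.mpr ⟨hd, hdn, hn0⟩)
    exact Finset.mem_singleton.mp this
  simp only [Set.mem_iUnion, Set.mem_range, Finset.coe_range, Set.mem_Iio]
  by_contra hmem
  push Not at hmem
  have hm : m₁ ≤ m := by
    by_contra hlt
    push Not at hlt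
    exact hmem m hlt ψ rfl
  have hm0 : m ≠ 0 := by omega
  have hmm₀ : m₀ ≤ m := le_trans (le_max_left _ _) hm
  -- Birch's formula: `L(f, ψ, 1) = 0` gives `∑_a ψ̄(a){∞, a/p^m}_f = 0`
  have hS : twistedSymbolSum f ψ⁻¹ = 0 := by
    have h := twisted_LValue_eq_holds f hprim hLd hL
    rw [hL1, mul_zero] at h
    exact h.symm
  -- the Galois family `ψ⟨ψ^r⟩` of `ψ`: primitive, constant parity, sparse support (offset `e`)
  set Xf : Finset (DirichletCharacter ℂ (p ^ m)) :=
    (Finset.range (orderOf (ψ ^ r))).image (fun j ↦ ψ * (ψ ^ r) ^ j) with hXf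
  have hmem' : ∀ χ' ∈ Xf, ∃ j, χ' = ψ ^ (1 + r * j) := fun χ' h ↦ by
    obtain ⟨j, -, hj⟩ := (mem_galoisCoset_iff ψ r).mp h
    exact ⟨j, hj⟩
  have hX : ∀ χ' ∈ Xf, χ'.IsPrimitive ∧ χ' (-1) = ψ (-1) := by
    intro χ' h
    obtain ⟨j, rfl⟩ := hmem' χ' h
    have hcop := coprime_orderOf_of_modEq_one hm0 ψ he1 (hmodr j)
    exact ⟨isPrimitive_pow_of_coprime hm0 hprim hcop, pow_apply_neg_one_of_coprime ψ hcop⟩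
  have hsupp : ∀ z : ZMod (p ^ m), ∑ χ ∈ Xf, χ z ≠ 0 →
      (ZMod.castHom (pow_dvd_pow p (Nat.sub_le m e)) (ZMod (p ^ (m - e))) z) ^ (2 * (p - 1)) = 1 := by
    intro z hz
    obtain ⟨hzu, hzr⟩ := isUnit_and_pow_eq_one_of_sum_galoisCoset_ne_zero ψ r hz
    obtain ⟨u, rfl⟩ := hzu
    exact castHom_pow_eq_one_of_apply_pow_eq_one_offset hm0 he1 hprim hzr
  obtain ⟨χ', hχ', hne⟩ := hm₀ m hmm₀ Xf (ψ (-1)) (galoisCoset_nonempty ψ r) hX hsupp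
  -- `χ'⁻¹ = (ψ⁻¹)^{1 + rj}` is an admissible conjugate of `ψ⁻¹`, so its symbol sum vanishes
  obtain ⟨j, rfl⟩ := hmem' χ' hχ'
  rw [← inv_pow] at hne
  exact hne (twistedSymbolSum_pow_eq_zero_of_modEq_one hf hm0 hS (le_of_eq hedef.symm) (hmodr j))

omit hp in
/-- **Rohrlich's theorem, `P = {p}`, for an arbitrary newform with a coefficient bound** — the
hypotheses of `Rohrlich1984_nonvanishing_twists.primePow` exactly (`p ∤ N` an arbitrary natural
number; for `p` not prime the statement is trivial), for a normalised newform `f ∈ S₂(Γ₀(N))` with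
`|aₙ(f)| ≤ C n^θ`, `θ < 2/3`, and no hypothesis on the coefficient field. With the
Ramanujan–Petersson bound for weight-`2` newforms this is the corollary
`Rohrlich1984_nonvanishing_twists.primePow` of the named fact in full.
[cite: RohrlichInventiones1984, Theorem (p. 409)] -/
theorem Rohrlich1984_nonvanishing_twists.primePow_of_coeffBound (hf : IsNewform0 f)
    {C θ : ℝ} (hC : 0 ≤ C) (hθ : 0 < θ) (hθ1 : θ < 2 / 3)
    (ha : ∀ n : ℕ, ‖cuspCoeff f n‖ ≤ C * (n : ℝ) ^ θ) {p : ℕ} (hpN : ¬ p ∣ N) :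
    Set.Finite {χ : Σ m : ℕ, DirichletCharacter ℂ m |
      χ.1 ≠ 0 ∧ χ.1.primeFactors ⊆ {p} ∧ χ.2.IsPrimitive ∧
        ∃ L : ℂ → ℂ, Differentiable ℂ L ∧
          (∀ s : ℂ, 2 < s.re → L s = twistedLSeries f χ.2 s) ∧ L 1 = 0} := by
  by_cases hp' : p.Prime
  · haveI : Fact p.Prime := ⟨hp'⟩
    exact Rohrlich1984_primePow_of_coeffBound hf hC hθ hθ1 ha hpN
  · exact finite_setOf_primeFactors_subset_singleton_of_not_prime hp' _

end MainGeneral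

end Literature.NumberTheory.EllipticCurves
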